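import Literature.AlgebraicGeometry.Movasati2017.PeriodMatrixRankLowerBound
import HarnessLib

/-!
# Villaflor's second gap for the Hodge locus at the Fermat point — Theorem 1.3, inequality (desteo2), in full

R. Villaflor Loyola, *Small codimension components of the Hodge locus containing the Fermat variety*,
Commun. Contemp. Math. 24 (2022) 2150053 = arXiv:2001.01019 [Villaflorloyola2021]. Verbatim from the held text
(chunks p0005, p0009, p0014 of `paper:arxiv-2001.01019`):

> **Theorem 1.3.** Let `n` be an even number, `d` be a number such that `ζ_d + ζ_d^{−1} ∉ ℚ` (i.e.
> `d ≠ 1,2,3,4,6`), `0 ∈ T` be the Fermat variety and `0 ∈ Σ` be a component of the Hodge locus different from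
> (complin). Then `codim_T Σ ≥ C(n/2+d, d) + C(n/2+d−1, d−1) − (3n²/8 + 9n/4 + 2)`.
> In fact for `d ≥ max{4, 2 + 6/n}`, if `0 ∈ Δ ⊆ T` is a polydisc and `λ ∈ Γ(Δ, R^nπ_*ℤ)` is such that `0 ∈ V_λ`
> but (igualdad1) does not hold, then
> (desteo2) `codim_{T_0T} T_0V_λ ≥ C(n/2+d, d) + C(n/2+d−1, d−1) − (3n²/8 + 9n/4 + 2)`.
> Furthermore, if the equality in (desteo2) is attained and `n ≥ 4`, then there exists a complete intersection
> `Z ⊆ ℙ^{n+1}` of type `(1,1,…,1,2)` such that `I(Z) ⊆ J^{F,λ}` […].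
>
> [(igualdad1), Proposition 4.1:] `dim_ℂ R^{F,λ}_d = C(n/2+d, d) − (n/2+1)²`.
>
> **Proposition 3.3.** Let `x^α` be any monomial. For every `d > 0` let `S^d_α := {x^β ∈ ℂ[x]_d : x^β | x^α}`.
> Then, for any `i ≠ j` such that `0 < α_i ≤ α_j`, `#S^d_{α'} ≤ #S^d_α` where `α'_k := α_k` for `k ≠ i,j`,
> `α'_i := α_i − 1` and `α'_j := α_j + 1`. […]
>
> **§7, Proof of Theorem 1.3.** […] Consider any monomial order and take
> `x^α ∈ ℂ[x]_σ ∖ ⟨LT(J^{F,λ})⟩_σ` for `σ = (d−2)(n/2+1) = soc(J^{F,λ})`. It follows from Proposition 4.1 and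
> Remark 4.1 that (dessalfa2) `dim_ℂ R^{F,λ}_d ≥ #S^d_α`.
> Case 1: If `x^α` is not of the form (monmin2) `x^α = x_{i_1}^{d−2} ⋯ x_{i_{n/2+1}}^{d−2}` […] then (desteo2)
> follows from (dessalfa2) and Proposition 3.3.
> Case 2: If `x^α` is of the form (monmin2) we can assume `x^α = x_1^{d−2} x_3^{d−2} ⋯ x_{n+1}^{d−2}` after some
> relabeling of the variables. Since (dessalfa2) is strict in this case, there must exist some
> `x^β ∈ ℂ[x]_d ∖ (⟨LT(J^{F,λ})⟩_d ∪ S^d_α)`. In consequence there exists some `i` even such that `x_i | x^β`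
> and so `x_i ∈ ℂ[x]_1 ∖ (⟨LT(J^{F,λ})⟩_1 ∪ S^1_α)`, i.e. `dim_ℂ R^{F,λ}_1 > #S^1_α`. By duality
> `dim_ℂ R^{F,λ}_{σ−1} > #S^{σ−1}_α` and so there exists some
> `x^{α'} ∈ ℂ[x]_{σ−1} ∖ (⟨LT(J^{F,λ})⟩_{σ−1} ∪ S^{σ−1}_α)`. By Proposition 4.1 it follows that
> `dim_ℂ R^{F,λ}_d ≥ #(S^d_α ∪ S^d_{α'}) = #S^d_α + #(S^d_{α'} ∖ S^d_γ)` where `γ_i = min{α_i, α'_i}` […].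
> Case 2.1: If `#{i : α'_i = d−2} = n/2`, then by Proposition 3.3 `#S^d_{α'} ≥ #S^d_{α_0}` for
> `α_0 := (0,…,0,1,d−4,d−2,…,d−2)`. Also in this case, up to some relabeling of the variables we can assume
> `x^γ | x_1^{d−4}(x_3 x_5 ⋯ x_{n+1})^{d−2}`, and so `#S^d_γ ≤ #S^d_{γ_0}` for `γ_0 := (0,…,0,d−4,d−2,…,d−2)`
> […]. Therefore `dim_ℂ R^{F,λ}_d ≥ #S^d_α + #S^d_{α_0} − #S^d_{γ_0} = C(n/2+d, d) + C(n/2+d−1, d−1) −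
> (3n²/8 + 9n/4 + 2)`. Case 2.2: […] `≥ C(n/2+d, d) + C(n/2+d−1, d−1) − (n²/4 + 5n/2 + 2) ≥ …`

§2 of the paper (Definition 2.1, Propositions 2.1–2.2) identifies `J^{F,λ}` with the graded annihilator
`Ann ℓ_λ` of the period functional `ℓ_λ` (tree `Kloosterman2025.annIdeal`), an Artinian Gorenstein ideal of socle
degree `σ = (n/2+1)(d−2)` containing the monomial Jacobian ideal `J^F = (x_0^{d−1},…,x_{n+1}^{d−1})`, and `(J^{F,λ})_d`
with the Zariski tangent space `T_0V_λ` (Voisin–Carlson–Griffiths; Movasati's `ker [p_{i+j}] = T_0V_{δ}`,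
[Movasati2016Periods] Thm. 6). Those transcendental identifications are NOT formalised (as in the tree's
`Movasati2017/PeriodMatrixRankLowerBound.lean`, whose Case 1 `ciHilbert_preFinal_le_hilbert_annIdeal` this file
completes). Everything below is the algebra/combinatorics of the printed proof, over an arbitrary field `K`, for
`m` variables and socle degree `t = (k+1)(d−2)` (Fermat `n`-fold: `m = n+2`, `k = n/2`).

## What this file PROVES (0 facts, 0 sorry)

* **Theorem 1.3, inequality (desteo2), at the level of `J^{F,λ} = Ann ℓ`** — `secondGap_le_hilbert_annIdeal`: for
  EVERY non-zero functional `ℓ` on `K[x_0,…,x_{m−1}]` concentrated in degree `t = (k+1)(d−2)`, `d ≥ 4`, killing the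
  monomials with an exponent `≥ d−1` (`J^F ⊆ Ann ℓ`), whose Hilbert function in degree `d` is NOT Movasati's value
  `C(k+d, d) − (k+1)²` ("(igualdad1) does not hold"), one has
  `HF_{Ann ℓ}(d) ≥ ciHilbert(2, d−2, (d−1)^k)(d)`, Kloosterman's `h_I(d)` for the complete intersection of type
  `(1^k, 2)` — by the tree's `Villaflor2022.secondGapBound_eq_ciLocusCodim` this is EXACTLY the printed
  `C(n/2+d,d) + C(n/2+d−1,d−1) − (3n²/8 + 9n/4 + 2)` (`n = 2k ≥ 2`). Equivalently (`hilbert_annIdeal_eq_or_secondGap_le`):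
  THE GAP — `HF_{Ann ℓ}(d)` is either Movasati's value or at least the `(1,…,1,2)` value; no value in between occurs.
  Colon form at the Fermat point (`(J^F : P)`, Duque Franco–Villaflor's `J^{F,λ} = (J^F : P_λ)`):
  `hilbert_fermat_colon_eq_or_secondGap_le`.
* **Census / period-matrix form** (Movasati's `[p_{i+j}]_{I_{(n/2)d−n−2} × I_d}`, tree `Movasati2016.periodMatrix`; the
  functional of a period vector `vectorFunctional`): for every admissible period vector `p` of the Fermat `n`-fold
  (`n = 2k ≥ 2`, `d ≥ 4`; zero outside Movasati's box, non-zero on `I_σ`),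
  `rank [p_{i+j}] = C(n/2+d,d) − (n/2+1)²` or `rank [p_{i+j}] ≥ ciLocusCodim (1^{n/2}, 2) d`
  (`rank_periodMatrix_eq_or_ciLocusCodim_le`; `(4,4)`: `6` or `≥ 8`; `(4,5)`: `12` or `≥ 19`; `(4,6)`: `19` or `≥ 32`;
  `(6,4)`: `19` or `≥ 26`), and the second value is ATTAINED, by the period vector of the pre-final monomial
  `x^{(1, d−3, (d−2)^k, 0, …)}` (`rank_periodMatrix_preFinalVector`), so that for `d ≥ max{4, 2+6/n}` it is the least
  rank other than Movasati's (`isLeast_rank_periodMatrix_ne_movasati`; companion of the tree's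
  `Movasati2017.isLeast_rank_periodMatrix`).
* **Every column degree** (v2; same proof, the printed statement being `M = d`): under the same hypotheses the WHOLE
  Hilbert function of `Ann ℓ` dominates the `(2, d−2, (d−1)^k)` complete-intersection one,
  `HF_{Ann ℓ}(M) ≥ ciHilbert(2, d−2, (d−1)^k)(M)` for all `M` (`secondGap_le_hilbert_annIdeal_all`; rank form for all
  the matrices `[p_{i+j}]_{I_{N'} × I_M}`, `M + N' = σ`: `rank_periodMatrix_eq_or_secondGap_le_all`), and the census rows
  as numerical instances (`rank_periodMatrix_quarticFourfold_eq_six_or_eight_le`: `(4,4)` rank `= 6 ∨ ≥ 8`;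
  `(4,5)` `12 ∨ ≥ 19`; `(4,6)` `19 ∨ ≥ 32`; `(6,4)` `19 ∨ ≥ 26`; `(8,4)` `45 ∨ ≥ 61`).
* Combinatorics (Proposition 3.3 in the generality needed): `ciHilbert_greedy_le_card_divSet` — among the box vectors
  `κ ∈ [0,c]^τ` of a given total degree `qc + r` (`r < c`) the divisor count `#S^M_κ` is minimised by the greedy shape
  `(c^q, r, 0, …)`, whose count is `ciHilbert((r+1), (c+1)^q)(M)`; the numerical identity `ciHilbert_secondGap_split`:
  `ciHilbert((c+1)^{k+1})(c+2) + ciHilbert(c−1, (c+1)^k)(c+1) = ciHilbert(2, c, (c+1)^k)(c+2)`.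

## FORMALISATION REMARK (one step of the printed Case 2.1, and the route used here)

The printed Case 2.1 asserts "by Proposition 3.3 `#S^d_{α'} ≥ #S^d_{α_0}`" for `α_0 = (0,…,0,1,d−4,d−2,…,d−2)`. As an
inequality between the two counts this does not follow from Proposition 3.3 and is false in general: Proposition 3.3
says that CONCENTRATING (`α ↦ α − e_i + e_j`, `0 < α_i ≤ α_j`) does not increase the count, so among the shapes of
degree `σ−1` with exactly `n/2` entries `d−2` the least count is at `(0,…,0,d−3,d−2,…,d−2)`, which is more concentrated
than `α_0`; and that shape occurs: for `(n,d) = (2,6)`, `ℓ = δ_{x_1^4x_3^4} + δ_{x_0^4x_1^4}` (`δ` = dual monomial basis of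
`K[x_0,…,x_3]_8`) and the lexicographic order with `x_0 > x_2 > x_1 > x_3`, the socle standard monomial is `x_1^4x_3^4`
(Case 2), `HF(6) = 5 ≠ 3` ((igualdad1) fails), the degree-`7` standard monomials are `x_1^3x_3^4, x_1^4x_3^3, x_0^3x_1^4`,
so `α' = (3,4,0,0)` is forced, `#{i : α'_i = 4} = 1 = n/2` (Case 2.1) and `#S^6_{α'} = 2 < 3 = #S^6_{α_0}`
(`α_0 = (0,1,2,4)`). What the printed proof USES, however, is only the difference
`#S^d_{α'} − #S^d_γ ≥ #S^d_{α_0} − #S^d_{γ_0}` (in the example `2 − 0 = 3 − 1`), and the conclusion (desteo2) holds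
(there `HF(6) = 5 = 2d − 7`, with equality). This file proves that difference bound directly and uniformly for BOTH
sub-cases 2.1/2.2, using only the printed ingredients (divisors of standard monomials are standard; duality;
Proposition 3.3): with `x^α = (x_E)^{d−2}` the socle standard monomial and `x^{α'}` standard of degree `σ−1`,
`x^{α'} ∤ x^α`, pick a variable `x_w ∉ E` dividing `x^{α'}`; the degree-`d` divisors of `x^{α'}` THROUGH `x_w` are
standard, lie outside `S^d_α`, and are in bijection with `S^{d−1}_{α'−e_w}`; `α' − e_w` is a box vector of degree
`σ − 2 = k(d−2) + (d−4)`, so by Proposition 3.3 (concentration, `ciHilbert_greedy_le_card_divSet`)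
`#S^{d−1}_{α'−e_w} ≥ #S^{d−1}_{((d−2)^k, d−4)} = #S^d_{α_0} − #S^d_{γ_0}`, and `#S^d_α + (#S^d_{α_0} − #S^d_{γ_0})` is the
printed bound (`ciHilbert_secondGap_split`). The equality clause of Theorem 1.3 (`n ≥ 4`: `I(Z) ⊆ J^{F,λ}` for a
`CI(1,…,1,2)`) and the component-level statement (which needs Theorem 1.2 and Proposition 2.1) are NOT formalised here.

HONEST FRAMING (cell pub-hlocus): certified instances and evidence bearing on the general Hodge conjecture; no claim.

## References
* R. Villaflor Loyola, Commun. Contemp. Math. 24 (2022) 2150053 = arXiv:2001.01019, Thm. 1.3, Props. 3.3, 4.1, §7.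
  [Villaflorloyola2021]
* H. Movasati, Asian J. Math. 21 (2017) 463–482 = arXiv:1411.1766, Thm. 2, §3.5 Props. 7–8. [Movasati2017GMCD]
* H. Movasati, arXiv:1602.06607, Def. 1, Thm. 6 (the matrix `[p_{i+j}]`). [Movasati2016Periods]
* R. Kloosterman, Rend. Sem. Mat. Univ. Padova 148 (2023) = arXiv:2104.14845, Prop. 3.2 (`h_I(e)` of `CI(1^k,2)`).
  [Kloosterman2023]
-/

noncomputable section

namespace Literature.AlgebraicGeometry.Villaflor2022

open Finset Literature.AlgebraicGeometry.Movasati2017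
open Literature.AlgebraicGeometry.Kloosterman2023 (ciHilbert ciHilbert_cons ciHilbert_one_cons ciHilbert_zero_cons
  ciLocusCodim)

/-! ## Combinatorics: Proposition 3.3 for an arbitrary total degree, and the numerical identity -/

section Combinatorics

variable {τ : Type*} [Fintype τ] [DecidableEq τ]

/-- Bookkeeping: the total of a function changed at one place. [folklore] -/
private theorem sum_update_add (g : τ → ℕ) (i : τ) (a : ℕ) :
    ∑ e, Function.update g i a e + g i = ∑ e, g e + a := by
  have h1 := Finset.sum_update_of_mem (Finset.mem_univ i) g a
  have h2 := Finset.sum_eq_add_sum_sdiff_singleton_of_mem (Finset.mem_univ i) g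
  omega

/-- One more unit in the first exponent bound: `h((a+1) :: R; M) = h(a :: R; M) + [a ≤ M]·h(R; M − a)` (the term
`j = a` of the peeling recursion). [cite: Kloosterman2023, §2 eq. (1)] -/
theorem ciHilbert_succ_cons' (a : ℕ) (R : List ℕ) (M : ℕ) :
    ciHilbert ((a + 1) :: R) M = ciHilbert (a :: R) M + (if a ≤ M then ciHilbert R (M - a) else 0) := by
  simp [ciHilbert_cons, List.range_succ]

/-- **The numerical identity behind Case 2** (`c = d − 2 ≥ 2`): Movasati's count plus the greedy count of degree
`σ − 2` in column degree `d − 1` is the `(1,…,1,2)` complete-intersection count —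
`ciHilbert((c+1)^{k+1})(c+2) + ciHilbert(c−1, (c+1)^k)(c+1) = ciHilbert(2, c, (c+1)^k)(c+2)`, i.e.
`#S^d_{((d−2)^{k+1})} + #S^{d−1}_{(d−4,(d−2)^k)} = #S^d_{(1,d−3,(d−2)^k)}` (Villaflor's
"`#S^d_α + #S^d_{α_0} − #S^d_{γ_0} = C(n/2+d,d) + C(n/2+d−1,d−1) − (3n²/8+9n/4+2)`"). [cite: Villaflorloyola2021, §7 Case 2.1]
[cite: Kloosterman2023, §2 eq. (1)] -/
theorem ciHilbert_secondGap_split (c : ℕ) (hc : 2 ≤ c) (R : List ℕ) :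
    ciHilbert ((c + 1) :: R) (c + 2) + ciHilbert ((c - 1) :: R) (c + 1) = ciHilbert (2 :: c :: R) (c + 2) := by
  have h1 := ciHilbert_succ_cons' c R (c + 2)
  rw [if_pos (by omega), show c + 2 - c = 2 by omega] at h1
  have h2 := ciHilbert_succ_cons' (c - 1) R (c + 1)
  rw [show c - 1 + 1 = c by omega, if_pos (by omega), show c + 1 - (c - 1) = 2 by omega] at h2
  have h3 := ciHilbert_succ_cons' 1 (c :: R) (c + 2)
  rw [show (1 : ℕ) + 1 = 2 from rfl, if_pos (by omega), ciHilbert_one_cons, show c + 2 - 1 = c + 1 by omega] at h3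
  omega

/-- **Proposition 3.3 for an arbitrary total degree (the greedy shape minimises the divisor count).** For a box
vector `κ ∈ [0,c]^τ` (`c ≥ 1`) of total degree `q·c + r` with `r < c`, and every column degree `M`:
`#S^M_κ ≥ ciHilbert((r+1), (c+1)^q)(M) = #S^M_{(c,…,c,r,0,…,0)}` — repeated shifts `κ ↦ κ − e_i + e_j` (`0 < κ_i ≤ κ_j < c`,
count non-increasing by the printed injection, tree `card_divSet_shift_le`) terminate (tree `potential_shift_lt`) at a
shape with at most one exponent strictly between `0` and `c`, which the total degree forces to be the greedy one; its
count is peeled off the variable carrying `r` (tree `card_divSet_peel`, `card_divSet_indicator`).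
[cite: Villaflorloyola2021, Proposition 3.3] [cite: Movasati2017GMCD, §3.5 Proposition 8] -/
theorem ciHilbert_greedy_le_card_divSet {c : ℕ} (hc : 1 ≤ c) {q r : ℕ} (hr : r < c) {κ : τ → ℕ}
    (hle : ∀ e, κ e ≤ c) (hsum : ∑ e, κ e = q * c + r) (M : ℕ) :
    ciHilbert ((r + 1) :: List.replicate q (c + 1)) M ≤ (divSet κ M).card := by
  classical
  suffices h : ∀ (μ : ℕ) (κ : τ → ℕ), ∑ e, κ e * (c - κ e) = μ → (∀ e, κ e ≤ c) →
      ∑ e, κ e = q * c + r → ciHilbert ((r + 1) :: List.replicate q (c + 1)) M ≤ (divSet κ M).card from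
    h _ κ rfl hle hsum
  intro μ
  induction μ using Nat.strong_induction_on with
  | _ μ ih =>
    intro κ hμ hle hsum
    by_cases hpair : ∃ i j, i ≠ j ∧ 0 < κ i ∧ κ i ≤ κ j ∧ κ j < c
    · -- shift and recurse
      obtain ⟨i, j, hij, hi, hij', hj⟩ := hpair
      have hlt := potential_shift_lt κ hij hi hij' hj
      rw [hμ] at hlt
      refine le_trans (ih _ hlt (shift κ i j) rfl (fun e => ?_) ?_) (card_divSet_shift_le κ hij hi hij' M)
      · by_cases hei : e = i
        · subst hei; rw [shift_apply_left κ hij]; have := hle e; omega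
        by_cases hej : e = j
        · subst hej; rw [shift_apply_right]; omega
        rw [shift_apply_of_ne κ hei hej]; exact hle e
      · rw [sum_shift κ hij hi, hsum]
    · -- terminal: at most one exponent strictly between `0` and `c`
      push Not at hpair
      have hone : ∀ a b, 0 < κ a → κ a < c → 0 < κ b → κ b < c → a = b := by
        intro a b ha hac hb hbc
        by_contra hab
        rcases le_total (κ a) (κ b) with h | h
        · exact absurd (hpair a b hab ha h) (by omega)
        · exact absurd (hpair b a (Ne.symm hab) hb h) (by omega)
      set E : Finset τ := Finset.univ.filter fun e => κ e = c with hE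
      have hsumE : ∑ e, (fun e => if e ∈ E then c else 0) e = E.card * c := by
        rw [← Finset.sum_filter, Finset.filter_mem_eq_inter, Finset.univ_inter, Finset.sum_const, smul_eq_mul]
      by_cases hmid : ∃ i, 0 < κ i ∧ κ i < c
      · -- one middle exponent `κ_i`, the others `0` or `c`: `κ = c·𝟙_E + κ_i e_i`
        obtain ⟨i, hi0, hic⟩ := hmid
        have hiE : i ∉ E := by
          simp only [hE, Finset.mem_filter, Finset.mem_univ, true_and]
          omega
        have hupd : Function.update κ i 0 = fun e => if e ∈ E then c else 0 := by
          funext e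
          by_cases hei : e = i
          · subst hei; simp [hiE]
          · rw [Function.update_of_ne hei]
            by_cases heE : e ∈ E
            · rw [if_pos heE]; simpa [hE] using heE
            · rw [if_neg heE]
              have hne : κ e ≠ c := by simpa [hE] using heE
              have hle' := hle e
              by_contra h0
              exact hei (hone e i (Nat.pos_of_ne_zero h0) (by omega) hi0 hic)
        have htot : ∑ e, κ e = E.card * c + κ i := by
          have h := sum_update_add κ i 0
          rw [hupd, hsumE] at h
          omega
        -- the total degree pins the shape: `κ_i = r`, `#E = q`
        have hmodr : (q * c + r) % c = r := by rw [Nat.add_comm, Nat.add_mul_mod_self_right, Nat.mod_eq_of_lt hr]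
        have hmodi : (E.card * c + κ i) % c = κ i := by
          rw [Nat.add_comm, Nat.add_mul_mod_self_right, Nat.mod_eq_of_lt hic]
        have hκi : κ i = r := by rw [← hmodi, ← htot, hsum, hmodr]
        have hq : E.card = q := by
          have h1 : E.card * c = q * c := by have := htot; rw [hsum, hκi] at this; omega
          exact Nat.eq_of_mul_eq_mul_right hc h1
        -- count, peeling the variable `i`
        have hcount : (divSet κ M).card = ciHilbert ((κ i + 1) :: List.replicate E.card (c + 1)) M := by
          rw [card_divSet_peel κ i M, ciHilbert_cons]
          congr 1
          refine List.map_congr_left fun a _ => ?_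
          split_ifs with haM
          · rw [hupd, card_divSet_indicator]
          · rfl
        rw [hcount, hκi, hq]
      · -- no middle exponent: `κ = c·𝟙_E`, `r = 0`, `#E = q`
        push Not at hmid
        have hκ : κ = fun e => if e ∈ E then c else 0 := by
          funext e
          by_cases heE : e ∈ E
          · rw [if_pos heE]; simpa [hE] using heE
          · rw [if_neg heE]
            have hne : κ e ≠ c := by simpa [hE] using heE
            have := hmid e
            have := hle e
            omega
        have htot : ∑ e, κ e = E.card * c := by conv_lhs => rw [hκ]; exact hsumE
        have hmodr : (q * c + r) % c = r := by rw [Nat.add_comm, Nat.add_mul_mod_self_right, Nat.mod_eq_of_lt hr]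
        have hr0 : r = 0 := by rw [← hmodr, ← hsum, htot, Nat.mul_mod_left]
        have hq : E.card = q := by
          have h1 : E.card * c = q * c := by rw [← htot, hsum, hr0, add_zero]
          exact Nat.eq_of_mul_eq_mul_right hc h1
        rw [hr0, zero_add, ciHilbert_one_cons, hκ, card_divSet_indicator, hq]

/-- The case used in the proof of Theorem 1.3: a box vector `κ ∈ [0,c]^τ`, `c ≥ 2`, of total degree
`(k+1)c − 2 = k·c + (c−2)` has `#S^M_κ ≥ ciHilbert(c−1, (c+1)^k)(M) = #S^M_{(c,…,c,c−2)}` — Villaflor's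
`#S^d_{α_0} − #S^d_{γ_0}` at `M = d − 1`, `c = d − 2`. [cite: Villaflorloyola2021, Proposition 3.3, §7 Case 2.1] -/
theorem ciHilbert_sub_two_le_card_divSet {c k : ℕ} (hc : 2 ≤ c) {κ : τ → ℕ} (hle : ∀ e, κ e ≤ c)
    (hsum : ∑ e, κ e + 2 = (k + 1) * c) (M : ℕ) :
    ciHilbert ((c - 1) :: List.replicate k (c + 1)) M ≤ (divSet κ M).card := by
  have hsum' : ∑ e, κ e = k * c + (c - 2) := by
    have : (k + 1) * c = k * c + c := by ring
    omega
  have h := ciHilbert_greedy_le_card_divSet (by omega) (q := k) (r := c - 2) (by omega) hle hsum' M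
  rwa [show c - 2 + 1 = c - 1 by omega] at h

end Combinatorics

/-! ## Theorem 1.3 (desteo2) for the Gorenstein ideal `J^{F,λ} = Ann ℓ` -/

section Functional

open MvPolynomial Module Movasati2016 Literature.RingTheory.MvPolynomial Literature.AlgebraicGeometry.Kloosterman2025

attribute [local instance] MvPolynomial.gradedAlgebra

variable {K : Type*} [Field K] {m d : ℕ}

open Classical in
/-- **Villaflor's Theorem 1.3, inequality (desteo2), at the tangent level — in full.** Let `ℓ ≠ 0` be a functional on
`K[x_0,…,x_{m−1}]` concentrated in degree `t = (k+1)(d−2)` (`d ≥ 4`) which kills every monomial with an exponent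
`≥ d − 1` (so `J^F ⊆ Ann ℓ`; for the Fermat `n`-fold `m = n+2`, `k = n/2`, `Ann ℓ_λ = J^{F,λ}`). If
`HF_{Ann ℓ}(d) ≠ C(k+d, d) − (k+1)²` ("(igualdad1) does not hold") then
`HF_{Ann ℓ}(d) ≥ ciHilbert(2, d−2, (d−1)^k)(d)` `= C(n/2+d,d) + C(n/2+d−1,d−1) − (3n²/8 + 9n/4 + 2)` (tree
`secondGapBound_eq_ciLocusCodim`). Case 1 of the printed proof is the tree's
`Movasati2017.ciHilbert_preFinal_le_hilbert_annIdeal`; Case 2 is proved by the uniform route of the module docstring.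
[cite: Villaflorloyola2021, Theorem 1.3, §7 (proof), Propositions 3.3 and 4.1] -/
theorem secondGap_le_hilbert_annIdeal {k : ℕ} (hd : 4 ≤ d) (ℓ : MvPolynomial (Fin m) K →ₗ[K] K)
    (hbox : ∀ s : Fin m →₀ ℕ, (∃ e, d - 1 ≤ s e) → ℓ (monomial s 1) = 0)
    {t : ℕ} (hℓ : ∀ q, ℓ (homogeneousComponent t q) = ℓ q) (ht : t = (k + 1) * (d - 2)) (hne : ℓ ≠ 0)
    (hneq : finrank K (homogeneousSubmodule (Fin m) K d) - finrank K (idealDegree (annIdeal ℓ) d) ≠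
      (k + d).choose d - (k + 1) ^ 2) :
    ciHilbert (2 :: (d - 2) :: List.replicate k (d - 1)) d ≤
      finrank K (homogeneousSubmodule (Fin m) K d) - finrank K (idealDegree (annIdeal ℓ) d) := by
  set mo : MonomialOrder (Fin m) := MonomialOrder.degLex with hmo
  set LE := leadingExponents mo (annIdeal ℓ) with hLEdef
  have hup : IsUpperSet LE := isUpperSet_leadingExponents mo _
  -- standard monomials of degree `u`, counting `HF(u)`
  set std : ℕ → Finset (Fin m →₀ ℕ) := fun u =>
    ((univ : Finset (Fin m)).finsuppAntidiag u).filter fun a => a ∉ LE with hstd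
  have hmem_std : ∀ u (β : Fin m →₀ ℕ), β ∈ std u ↔ (∑ i, β i = u) ∧ β ∉ LE := by
    intro u β
    rw [hstd, Finset.mem_filter, Literature.RingTheory.MvPolynomial.mem_finsuppAntidiag_univ_iff,
      Finsupp.degree_eq_sum]
  have hHF : ∀ u, finrank K (homogeneousSubmodule (Fin m) K u) - finrank K (idealDegree (annIdeal ℓ) u) =
      (std u).card := fun u => hilbert_annIdeal_eq_card_standard mo ℓ hℓ u
  -- the socle standard monomial `x^α` (in the box)
  obtain ⟨α, hαsum, hαE, hαbox⟩ := exists_standard_socle mo ℓ hbox hℓ hne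
  by_cases hmid : ∃ e, 0 < α e ∧ α e < d - 2
  · -- Case 1 (printed): `x^α` not concentrated
    exact ciHilbert_preFinal_le_hilbert_annIdeal mo ℓ hbox hℓ ht hαsum hαE hmid d
  -- Case 2: `x^α = (x_F)^{d−2}`, `#F = k+1`
  push Not at hmid
  have hconc : ∀ e, α e = 0 ∨ α e = d - 2 := fun e => by
    have h1 := hmid e; have h2 := hαbox e
    by_cases h0 : α e = 0
    · exact Or.inl h0
    · exact Or.inr (le_antisymm h2 (h1 (Nat.pos_of_ne_zero h0)))
  set F : Finset (Fin m) := univ.filter fun e => α e = d - 2 with hF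
  have hαF : (⇑α : Fin m → ℕ) = fun e => if e ∈ F then d - 2 else 0 := by
    funext e
    by_cases he : e ∈ F
    · rw [if_pos he]; simpa [hF] using he
    · rw [if_neg he]
      have hne' : α e ≠ d - 2 := by simpa [hF] using he
      rcases hconc e with h0 | h2
      · exact h0
      · exact absurd h2 hne'
  have hcardF : F.card = k + 1 := by
    have h1 : ∑ e, (⇑α) e = F.card * (d - 2) := by
      rw [hαF, ← Finset.sum_filter, Finset.filter_mem_eq_inter, Finset.univ_inter, Finset.sum_const, smul_eq_mul]
    rw [hαsum, ht] at h1
    exact (Nat.eq_of_mul_eq_mul_right (by omega) h1).symm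
  -- divisors of `x^α` are standard; standard exponents lie in the box
  have hdiv : ∀ β : Fin m →₀ ℕ, β ≤ α → β ∉ LE := fun β hβ hβE => hαE (hup hβ hβE)
  have hstd_box : ∀ β : Fin m →₀ ℕ, β ∉ LE → ∀ e, β e ≤ d - 2 := by
    intro β hβ e
    by_contra h
    push Not at h
    refine hβ ⟨monomial β 1, Movasati2017.monomial_mem_annIdeal_of_le ℓ hbox ⟨e, by omega⟩,
      monomial_eq_zero.not.mpr one_ne_zero, ?_⟩
    rw [MonomialOrder.degree_monomial, if_neg one_ne_zero]
  -- if there are more standard monomials of degree `u` than divisors of `x^α`, one of them does not divide `x^α`,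
  -- and it involves a variable `x_w`, `w ∉ F`
  have hexists : ∀ u, (divSet (⇑α) u).card < (std u).card →
      ∃ β : Fin m →₀ ℕ, (∑ i, β i = u) ∧ β ∉ LE ∧ ∃ w, w ∉ F ∧ 1 ≤ β w := by
    intro u hlt
    have himg : ((divSet (⇑α) u).image fun j => Finsupp.equivFunOnFinite.symm j).card < (std u).card := by
      rwa [Finset.card_image_of_injective _ Finsupp.equivFunOnFinite.symm.injective]
    obtain ⟨β, hβstd, hβnot⟩ := Finset.exists_mem_notMem_of_card_lt_card himg
    obtain ⟨hβsum, hβE⟩ := (hmem_std u β).mp hβstd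
    have hnotle : ¬ β ≤ α := by
      intro hle
      refine hβnot (Finset.mem_image.mpr ⟨⇑β, mem_divSet.mpr ⟨fun e => hle e, hβsum⟩, ?_⟩)
      exact Finsupp.equivFunOnFinite_symm_coe β
    obtain ⟨w, hw⟩ : ∃ w, α w < β w := by
      by_contra h
      push Not at h
      exact hnotle fun e => h e
    have hαw : α w = 0 := by
      have := hstd_box β hβE w
      rcases hconc w with h0 | h2
      · exact h0
      · omega
    refine ⟨β, hβsum, hβE, w, ?_, by omega⟩
    simp only [hF, Finset.mem_filter, Finset.mem_univ, true_and]
    omega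
  -- degree `d`: `#S^d_α` is Movasati's value, and (dessalfa2) is strict
  have hcount_d : (divSet (⇑α) d).card = ciHilbert (List.replicate (k + 1) (d - 1)) d := by
    rw [hαF, card_divSet_indicator, hcardF, show d - 2 + 1 = d - 1 by omega]
  have hle_d : (divSet (⇑α) d).card ≤ (std d).card := by
    rw [← hHF]; exact card_divSet_le_hilbert_annIdeal_of_notMem mo ℓ hℓ hαE d
  have hlt_d : (divSet (⇑α) d).card < (std d).card := by
    rcases hle_d.eq_or_lt with h | h
    · exfalso
      apply hneq
      rw [hHF d, ← h, hcount_d, ciHilbert_replicate_eq_choose_sub_sq k (by omega)]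
    · exact h
  obtain ⟨μ, -, hμE, v, hvF, hμv⟩ := hexists d hlt_d
  -- degree `1`: the `k + 2` coordinate vectors `e_e`, `e ∈ F ∪ {v}`, are standard
  have hstd1 : k + 2 ≤ (std 1).card := by
    have hinj : Function.Injective fun e : Fin m => Finsupp.single e (1 : ℕ) :=
      Finsupp.single_left_injective one_ne_zero
    have hsub : (insert v F).image (fun e => Finsupp.single e (1 : ℕ)) ⊆ std 1 := by
      intro β hβ
      obtain ⟨e, he, rfl⟩ := Finset.mem_image.mp hβ
      rw [hmem_std]
      refine ⟨by simp, ?_⟩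
      rcases Finset.mem_insert.mp he with rfl | heF
      · exact fun hin => hμE (hup (Finsupp.single_le_iff.mpr hμv) hin)
      · have hαe : α e = d - 2 := by simpa [hF] using heF
        exact hdiv _ (Finsupp.single_le_iff.mpr (by rw [hαe]; omega))
    calc k + 2 = (insert v F).card := by rw [Finset.card_insert_of_notMem hvF, hcardF]
      _ = ((insert v F).image fun e => Finsupp.single e (1 : ℕ)).card :=
          (Finset.card_image_of_injective _ hinj).symm
      _ ≤ (std 1).card := Finset.card_le_card hsub
  -- duality `HF(t−1) = HF(1) ≥ k + 2 > k + 1 = #S^{t−1}_α`: a standard `x^β` of degree `t−1` not dividing `x^α`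
  have ht2 : 2 ≤ t := by
    rw [ht]
    calc 2 ≤ d - 2 := by omega
      _ = 1 * (d - 2) := (one_mul _).symm
      _ ≤ (k + 1) * (d - 2) := Nat.mul_le_mul_right _ (by omega)
  have hsymm := hilbert_annIdeal_symm (σ := Fin m) hℓ (a := 1) (b := t - 1) (by omega)
  have hval : (divSet (⇑α) (t - 1)).card = k + 1 := by
    rw [hαF, card_divSet_indicator, hcardF, ht]
    exact (ciHilbert_replicate_one_and_sub_one k (c := d - 2) (by omega)).2
  have hlt_t : (divSet (⇑α) (t - 1)).card < (std (t - 1)).card := by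
    rw [hval, ← hHF (t - 1), ← hsymm, hHF 1]
    omega
  obtain ⟨β, hβsum, hβE, w, hwF, hβw⟩ := hexists (t - 1) hlt_t
  have hβbox := hstd_box β hβE
  have hαw0 : α w = 0 := by
    have h := congr_fun hαF w
    simp only [if_neg hwF] at h
    exact h
  -- the degree-`d` divisors of `x^β` through `x_w`: standard, and disjoint from the divisors of `x^α`
  set D : Finset (Fin m → ℕ) := (divSet (⇑β) d).filter fun j => 1 ≤ j w with hD
  have hsum_le : (divSet (⇑α) d).card + D.card ≤ (std d).card := by
    have hdisj : Disjoint (divSet (⇑α) d) D := by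
      rw [Finset.disjoint_left]
      intro j hjα hjD
      have h1 : j w ≤ α w := (mem_divSet.mp hjα).1 w
      have h2 := (Finset.mem_filter.mp hjD).2
      omega
    rw [← Finset.card_union_of_disjoint hdisj]
    refine Finset.card_le_card_of_injOn (fun j => Finsupp.equivFunOnFinite.symm j) (fun j hj => ?_)
      (fun _ _ _ _ h => Finsupp.equivFunOnFinite.symm.injective h)
    rw [Finset.mem_coe, hmem_std]
    rcases Finset.mem_union.mp (Finset.mem_coe.mp hj) with hj | hj
    · obtain ⟨hle, hs⟩ := mem_divSet.mp hj
      exact ⟨by simpa using hs, hdiv _ fun e => by simpa using hle e⟩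
    · obtain ⟨hj, -⟩ := Finset.mem_filter.mp hj
      obtain ⟨hle, hs⟩ := mem_divSet.mp hj
      exact ⟨by simpa using hs, fun hin => hβE (hup (show Finsupp.equivFunOnFinite.symm j ≤ β from
        fun e => by simpa using hle e) hin)⟩
  -- … in bijection with the degree-`(d−1)` divisors of `x^β / x_w`
  set κ : Fin m → ℕ := Function.update (⇑β) w (β w - 1) with hκ
  have hκw : κ w = β w - 1 := by simp [hκ]
  have hκne : ∀ e, e ≠ w → κ e = β e := fun e he => by simp [hκ, he]
  have hDcard : D.card = (divSet κ (d - 1)).card := by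
    refine Finset.card_nbij' (fun j => Function.update j w (j w - 1)) (fun g => Function.update g w (g w + 1))
      (fun j hj => ?_) (fun g hg => ?_) (fun j hj => ?_) (fun g hg => ?_)
    · obtain ⟨hj, hjw⟩ := Finset.mem_filter.mp (Finset.mem_coe.mp hj)
      obtain ⟨hle, hs⟩ := mem_divSet.mp hj
      rw [Finset.mem_coe, mem_divSet]
      refine ⟨fun e => ?_, ?_⟩
      · dsimp only
        by_cases hew : e = w
        · rw [hew, Function.update_self, hκw]; have := hle w; omega
        · rw [Function.update_of_ne hew, hκne e hew]; exact hle e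
      · dsimp only
        have h := sum_update_add j w (j w - 1)
        omega
    · obtain ⟨hle, hs⟩ := mem_divSet.mp (Finset.mem_coe.mp hg)
      rw [Finset.mem_coe, Finset.mem_filter, mem_divSet]
      refine ⟨⟨fun e => ?_, ?_⟩, by simp⟩
      · dsimp only
        by_cases hew : e = w
        · rw [hew, Function.update_self]; have := hle w; rw [hκw] at this; omega
        · rw [Function.update_of_ne hew]; have := hle e; rwa [hκne e hew] at this
      · dsimp only
        have h := sum_update_add g w (g w + 1)
        omega
    · obtain ⟨-, hjw⟩ := Finset.mem_filter.mp (Finset.mem_coe.mp hj)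
      funext e
      dsimp only
      by_cases hew : e = w
      · rw [hew, Function.update_self, Function.update_self]; omega
      · rw [Function.update_of_ne hew, Function.update_of_ne hew]
    · funext e
      dsimp only
      by_cases hew : e = w
      · rw [hew, Function.update_self, Function.update_self]; omega
      · rw [Function.update_of_ne hew, Function.update_of_ne hew]
  -- `x^β / x_w` is a box vector of degree `t − 2 = k(d−2) + (d−4)`: Proposition 3.3 bounds its count below
  have hκle : ∀ e, κ e ≤ d - 2 := fun e => by
    by_cases hew : e = w
    · subst hew; rw [hκw]; have := hβbox e; omega
    · rw [hκne e hew]; exact hβbox e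
  have hκsum : ∑ e, κ e + 2 = (k + 1) * (d - 2) := by
    have h := sum_update_add (⇑β) w (β w - 1)
    rw [← ht]
    change ∑ e, κ e + β w = ∑ e, (⇑β) e + (β w - 1) at h
    omega
  have hgreedy := ciHilbert_sub_two_le_card_divSet (c := d - 2) (k := k) (by omega) hκle hκsum (d - 1)
  rw [show d - 2 - 1 = d - 3 by omega, show d - 2 + 1 = d - 1 by omega] at hgreedy
  -- assemble with the numerical identity
  have hsplit := ciHilbert_secondGap_split (d - 2) (by omega) (List.replicate k (d - 1))
  rw [show d - 2 + 1 = d - 1 by omega, show d - 2 + 2 = d by omega, show d - 2 - 1 = d - 3 by omega] at hsplit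
  rw [← hsplit, hHF d]
  have e1 : ciHilbert ((d - 1) :: List.replicate k (d - 1)) d = (divSet (⇑α) d).card := by
    rw [hcount_d, List.replicate_succ]
  omega

/-- **The gap.** For every such `ℓ` (`d ≥ 4`), `HF_{Ann ℓ}(d)` is either Movasati's value `C(k+d,d) − (k+1)²`
(the loci of linear cycles, Theorem 1.1) or at least the `(1,…,1,2)` complete-intersection value
`ciHilbert(2, d−2, (d−1)^k)(d)`: no intermediate tangent codimension occurs at the Fermat point.
[cite: Villaflorloyola2021, Theorem 1.3, Proposition 4.1] -/
theorem hilbert_annIdeal_eq_or_secondGap_le {k : ℕ} (hd : 4 ≤ d) (ℓ : MvPolynomial (Fin m) K →ₗ[K] K)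
    (hbox : ∀ s : Fin m →₀ ℕ, (∃ e, d - 1 ≤ s e) → ℓ (monomial s 1) = 0)
    {t : ℕ} (hℓ : ∀ q, ℓ (homogeneousComponent t q) = ℓ q) (ht : t = (k + 1) * (d - 2)) (hne : ℓ ≠ 0) :
    finrank K (homogeneousSubmodule (Fin m) K d) - finrank K (idealDegree (annIdeal ℓ) d) =
        (k + d).choose d - (k + 1) ^ 2 ∨
      ciHilbert (2 :: (d - 2) :: List.replicate k (d - 1)) d ≤
        finrank K (homogeneousSubmodule (Fin m) K d) - finrank K (idealDegree (annIdeal ℓ) d) := by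
  by_cases h : finrank K (homogeneousSubmodule (Fin m) K d) - finrank K (idealDegree (annIdeal ℓ) d) =
      (k + d).choose d - (k + 1) ^ 2
  · exact Or.inl h
  · exact Or.inr (secondGap_le_hilbert_annIdeal hd ℓ hbox hℓ ht hne h)

/-- Numerical reading: no value strictly between the two bounds is the degree-`d` Hilbert function of such an
`Ann ℓ`. [cite: Villaflorloyola2021, Theorem 1.3] -/
theorem hilbert_annIdeal_not_mem_Ioo {k : ℕ} (hd : 4 ≤ d) (ℓ : MvPolynomial (Fin m) K →ₗ[K] K)
    (hbox : ∀ s : Fin m →₀ ℕ, (∃ e, d - 1 ≤ s e) → ℓ (monomial s 1) = 0)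
    {t : ℕ} (hℓ : ∀ q, ℓ (homogeneousComponent t q) = ℓ q) (ht : t = (k + 1) * (d - 2)) (hne : ℓ ≠ 0) :
    finrank K (homogeneousSubmodule (Fin m) K d) - finrank K (idealDegree (annIdeal ℓ) d) ∉
      Set.Ioo ((k + d).choose d - (k + 1) ^ 2) (ciHilbert (2 :: (d - 2) :: List.replicate k (d - 1)) d) := by
  rintro ⟨h1, h2⟩
  rcases hilbert_annIdeal_eq_or_secondGap_le hd ℓ hbox hℓ ht hne with h | h
  · omega
  · omega

end Functional

/-! ## The colon ideals `(J^F : P)` of the Fermat Jacobian ideal -/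

section Fermat

open MvPolynomial Module Literature.RingTheory.MvPolynomial Literature.AlgebraicGeometry.Kloosterman2025
  Literature.AlgebraicGeometry.HodgeTheory

attribute [local instance] MvPolynomial.gradedAlgebra

variable {K : Type*} [Field K] {m d : ℕ}

/-- **Theorem 1.3 (desteo2) for `J^{F,λ} = (J^F : P_λ)` at the Fermat point.** `J = (x_0^{d−1},…,x_{m−1}^{d−1})` (the
Jacobian ideal of `Σ x_i^d`, `d ∈ K^×`, `d ≥ 4`), `P ∉ J` a form of degree `e₀` with `e₀ + t = m(d−2)` and
`t = (k+1)(d−2)` (Fermat `n`-fold: `m = n+2`, `k = n/2`, `e₀ = t = σ`, `P = P_λ`, Duque Franco–Villaflor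
Def. 2.2 / Villaflor Prop. 2.2): `dim S_d − dim (J : P)_d` is `C(k+d,d) − (k+1)²` or at least
`ciHilbert(2, d−2, (d−1)^k)(d)`. [cite: Villaflorloyola2021, Theorem 1.3, Proposition 2.2, Proposition 4.1] -/
theorem hilbert_fermat_colon_eq_or_secondGap_le {k : ℕ} (hd : 4 ≤ d) {P : MvPolynomial (Fin m) K} {e₀ t : ℕ}
    (hP : P.IsHomogeneous e₀) (het : e₀ + t = m * (d - 2)) (ht : t = (k + 1) * (d - 2))
    (hPJ : P ∉ Ideal.span (Set.range fun i : Fin m => (X i : MvPolynomial (Fin m) K) ^ (d - 1))) :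
    finrank K (homogeneousSubmodule (Fin m) K d) -
        finrank K (idealDegree
          ((Ideal.span (Set.range fun i : Fin m => (X i : MvPolynomial (Fin m) K) ^ (d - 1))).colon {P}) d) =
        (k + d).choose d - (k + 1) ^ 2 ∨
      ciHilbert (2 :: (d - 2) :: List.replicate k (d - 1)) d ≤
        finrank K (homogeneousSubmodule (Fin m) K d) -
          finrank K (idealDegree
            ((Ideal.span (Set.range fun i : Fin m => (X i : MvPolynomial (Fin m) K) ^ (d - 1))).colon {P}) d) := by
  classical
  have he : 1 ≤ d - 1 := by omega
  set ℓP := fermatSocleFunctional K (Fin m) (d - 1) ∘ₗ LinearMap.mulRight K P with hℓP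
  rw [span_X_pow_colon_eq_annIdeal he P]
  refine hilbert_annIdeal_eq_or_secondGap_le hd ℓP (fun s hs => ?_) (fun q => ?_) ht ?_
  · -- `x^s ∈ J ⊆ Ann(ℓ_P)` for a box-leaving `s`
    have hsJ : (monomial s (1 : K)) ∈
        Ideal.span (Set.range fun i : Fin m => (X i : MvPolynomial (Fin m) K) ^ (d - 1)) := by
      rw [mem_span_X_pow_iff]
      intro c hc
      rw [Finset.mem_singleton.mp (support_monomial_subset hc)]
      exact hs
    refine apply_eq_zero_of_mem_annIdeal (annIdeal_le_annIdeal_comp_mulRight _ P ?_)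
    rwa [annIdeal_fermatSocleFunctional he]
  · -- `ℓ_P` is concentrated in degree `t`
    have het' : e₀ + t = Fintype.card (Fin m) * (d - 1 - 1) := by
      rw [Fintype.card_fin, show d - 1 - 1 = d - 2 by omega]
      exact het
    exact comp_mulRight_homogeneousComponent fermatSocleFunctional_homogeneousComponent hP het' q
  · -- `ℓ_P ≠ 0` since `P ∉ J`
    intro h0
    have htop : annIdeal ℓP = ⊤ := annIdeal_eq_top_iff.mpr h0
    rw [hℓP, annIdeal_comp_mulRight_eq_top_iff, annIdeal_fermatSocleFunctional he] at htop
    exact hPJ htop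

end Fermat

/-! ## The period-matrix (census) form -/

section PeriodMatrix

open MvPolynomial Module Movasati2016 Literature.RingTheory.MvPolynomial Literature.AlgebraicGeometry.Kloosterman2025

attribute [local instance] MvPolynomial.gradedAlgebra

variable {K : Type*} [Field K] {m d : ℕ}

/-- **The functional of a period vector**: `ℓ_p(q) := Σ_{|s| = t} p_s · coeff_s(q)` — the linear functional on
`K[x_0,…,x_{m−1}]`, concentrated in degree `t`, whose periods `ℓ_p(x^s)` are the prescribed `p_s` (`|s| = t`);
Villaflor's Definition 2.1 read backwards (`J^{F,λ} = Ann ℓ_λ`, `ℓ_λ(x^i) = p_i(λ)`), Movasati's Definition 1.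
[cite: Villaflorloyola2021, Definition 2.1] [cite: Movasati2016Periods, Definition 1] -/
def vectorFunctional (m t : ℕ) (p : (Fin m → ℕ) → K) : MvPolynomial (Fin m) K →ₗ[K] K :=
  ∑ s ∈ (Finset.univ : Finset (Fin m)).finsuppAntidiag t, p ⇑s • lcoeff K s

/-- `ℓ_p(x^s) = p_s` for `|s| = t`, and `0` in other degrees. [cite: Villaflorloyola2021, Definition 2.1] -/
theorem vectorFunctional_monomial (t : ℕ) (p : (Fin m → ℕ) → K) (s : Fin m →₀ ℕ) :
    vectorFunctional m t p (monomial s 1) = if s.degree = t then p ⇑s else 0 := by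
  classical
  rw [vectorFunctional, LinearMap.sum_apply]
  simp only [LinearMap.smul_apply, lcoeff_apply, coeff_monomial, smul_eq_mul, mul_ite, mul_one, mul_zero]
  rw [Finset.sum_ite_eq]
  simp only [Literature.RingTheory.MvPolynomial.mem_finsuppAntidiag_univ_iff]

/-- `ℓ_p` is concentrated in degree `t`. [cite: Villaflorloyola2021, Definition 2.1] -/
theorem vectorFunctional_homogeneousComponent (t : ℕ) (p : (Fin m → ℕ) → K) (q : MvPolynomial (Fin m) K) :
    vectorFunctional m t p (homogeneousComponent t q) = vectorFunctional m t p q := by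
  classical
  rw [vectorFunctional, LinearMap.sum_apply, LinearMap.sum_apply]
  refine Finset.sum_congr rfl fun s hs => ?_
  have hst : s.degree = t := Literature.RingTheory.MvPolynomial.mem_finsuppAntidiag_univ_iff.mp hs
  simp only [LinearMap.smul_apply, lcoeff_apply, coeff_homogeneousComponent, if_pos hst]

/-- The period vector of `ℓ_p` is `p` in degree `t`. [cite: Movasati2016Periods, Definition 1] -/
theorem periodVector_vectorFunctional (t : ℕ) (p : (Fin m → ℕ) → K) {i : Fin m → ℕ} (hi : ∑ e, i e = t) :
    periodVector (vectorFunctional m t p) i = p i := by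
  have hdeg : (Finsupp.equivFunOnFinite.symm i).degree = t := by
    rw [Finsupp.degree_eq_sum]; simpa using hi
  rw [periodVector, vectorFunctional_monomial, if_pos hdeg, Finsupp.coe_equivFunOnFinite_symm]

/-- The matrix `[p_{i+j}]_{I_N × I_M}` only reads `p` in degree `M + N = t`, where `ℓ_p` has the same periods.
[cite: Movasati2016Periods, Definition 1] -/
theorem periodMatrix_vectorFunctional {t N M : ℕ} (hMN : M + N = t) (p : (Fin m → ℕ) → K) :
    periodMatrix m d N M (periodVector (vectorFunctional m t p)) = periodMatrix m d N M p := by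
  ext i j
  rw [periodMatrix_apply, periodMatrix_apply, periodVector_vectorFunctional t p]
  show ∑ e, (i.1 e + j.1 e) = t
  rw [Finset.sum_add_distrib, (mem_indexSet.mp i.2).2, (mem_indexSet.mp j.2).2]
  omega

/-- **Theorem 1.3 (desteo2) for Movasati's period matrix.** `m` variables, `d ≥ 4`, `d + N = (k+1)(d−2)`; `p` a period
vector vanishing on the box-leaving exponents and not identically zero on `I_{d+N}`: the rank of
`[p_{i+j}]_{I_N × I_d}` is `C(k+d,d) − (k+1)²` or at least `ciHilbert(2, d−2, (d−1)^k)(d)` (via the tree's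
`rank [p_{i+j}] = HF_{Ann ℓ_p}(d)`, [Movasati2016Periods] Thm. 6 / Villaflor Prop. 2.1 in algebraic form).
[cite: Villaflorloyola2021, Theorem 1.3] [cite: Movasati2016Periods, Definition 1, Theorem 6] -/
theorem rank_periodMatrix_eq_or_secondGap_le {k N : ℕ} (hd : 4 ≤ d) (hN : d + N = (k + 1) * (d - 2))
    (p : (Fin m → ℕ) → K) (hbox : ∀ i : Fin m → ℕ, (∃ e, d - 1 ≤ i e) → p i = 0)
    (hne : ∃ i ∈ indexSet m d (d + N), p i ≠ 0) :
    (periodMatrix m d N d p).rank = (k + d).choose d - (k + 1) ^ 2 ∨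
      ciHilbert (2 :: (d - 2) :: List.replicate k (d - 1)) d ≤ (periodMatrix m d N d p).rank := by
  classical
  set ℓ := vectorFunctional m (d + N) p with hℓdef
  have hbox' : ∀ s : Fin m →₀ ℕ, (∃ e, d - 1 ≤ s e) → ℓ (monomial s 1) = 0 := by
    intro s hs
    rw [hℓdef, vectorFunctional_monomial]
    split_ifs
    · exact hbox _ hs
    · rfl
  have hℓ : ∀ q, ℓ (homogeneousComponent (d + N) q) = ℓ q := vectorFunctional_homogeneousComponent _ p
  have hne' : ℓ ≠ 0 := by
    obtain ⟨i, hi, hpi⟩ := hne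
    intro h0
    apply hpi
    have h1 := periodVector_vectorFunctional (d + N) p (mem_indexSet.mp hi).2
    rw [← h1, periodVector, ← hℓdef, h0, LinearMap.zero_apply]
  rw [← periodMatrix_vectorFunctional rfl p, ← hℓdef, rank_periodMatrix_eq_hilbert ℓ hbox' hℓ rfl]
  exact hilbert_annIdeal_eq_or_secondGap_le hd ℓ hbox' hℓ hN hne'

/-- Degree bookkeeping: `d + ((n/2)d − n − 2) = (n/2+1)(d−2)` for `n = 2k`, `n + 2 ≤ k·d`. [folklore] -/
private theorem deg_add_rowDeg' {n k : ℕ} (hk : n = 2 * k) (hN : n + 2 ≤ k * d) :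
    d + (k * d - n - 2) = (k + 1) * (d - 2) := by
  subst hk
  obtain ⟨d', rfl⟩ : ∃ d', d = d' + 2 := ⟨d - 2, by
    by_contra h
    have : k * d ≤ k * 1 := Nat.mul_le_mul_left k (by omega)
    omega⟩
  have e1 : (k + 1) * (d' + 2 - 2) = k * d' + d' := by rw [Nat.add_sub_cancel]; ring
  have e2 : k * (d' + 2) = k * d' + 2 * k := by ring
  rw [e2] at hN
  rw [e1, e2]
  omega

variable {n : ℕ}

/-- **Census form (Fermat `n`-fold, `n = 2k ≥ 2`, `d ≥ 4`).** For EVERY admissible period vector `p` — zero outside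
Movasati's box, non-zero somewhere on `I_{(n/2+1)(d−2)}` — the matrix `[p_{i+j}]` of Definition 1 (rows
`I_{(n/2)d−n−2}`, columns `I_d`) has rank `C(n/2+d, d) − (n/2+1)²` (the value of the linear cycles) or rank
`≥ ciLocusCodim (1^{n/2}, 2) d`, the `(1,…,1,2)` complete-intersection codimension
`= C(n/2+d,d) + C(n/2+d−1,d−1) − (3n²/8 + 9n/4 + 2)` (`secondGapBound_eq_ciLocusCodim`): `(4,4)`: `6` or `≥ 8`;
`(4,5)`: `12` or `≥ 19`; `(4,6)`: `19` or `≥ 32`; `(6,4)`: `19` or `≥ 26`. With [Movasati2016Periods] Thm. 6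
(`ker [p_{i+j}] = T_0V_δ`, not formalised) this is (desteo2) for every Hodge class at the Fermat point.
[cite: Villaflorloyola2021, Theorem 1.3] [cite: Movasati2017GMCD, Theorem 2] [cite: Kloosterman2023, Prop. 3.2] -/
theorem rank_periodMatrix_eq_or_ciLocusCodim_le (hn : Even n) (hn2 : 2 ≤ n) (hd : 4 ≤ d)
    (p : (Fin (n + 2) → ℕ) → K) (hbox : ∀ i : Fin (n + 2) → ℕ, (∃ e, d - 1 ≤ i e) → p i = 0)
    (hne : ∃ i ∈ indexSet (n + 2) d ((n / 2 + 1) * (d - 2)), p i ≠ 0) :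
    (periodMatrix (n + 2) d (n / 2 * d - n - 2) d p).rank = (n / 2 + d).choose d - (n / 2 + 1) ^ 2 ∨
      ciLocusCodim (List.replicate (n / 2) 1 ++ [2]) d ≤ (periodMatrix (n + 2) d (n / 2 * d - n - 2) d p).rank := by
  have hk : n = 2 * (n / 2) := by obtain ⟨r, hr⟩ := hn; omega
  have hN : n + 2 ≤ n / 2 * d := by
    have : n / 2 * 4 ≤ n / 2 * d := Nat.mul_le_mul_left _ hd
    omega
  have hdeg := deg_add_rowDeg' hk hN
  rw [← hdeg] at hne
  rw [← ciHilbert_preFinal_eq_ciLocusCodim (n / 2) d (by omega)]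
  exact rank_periodMatrix_eq_or_secondGap_le hd hdeg p hbox hne

/-- The same with the tree's names for both bounds: `Villaflor2022.movasatiBound n d` and
`Villaflor2022.secondGapBound n d` (over `ℚ`). [cite: Villaflorloyola2021, Theorem 1.3, (cota)] -/
theorem rank_periodMatrix_eq_movasatiBound_or_secondGapBound_le (hn : Even n) (hn2 : 2 ≤ n) (hd : 4 ≤ d)
    (p : (Fin (n + 2) → ℕ) → K) (hbox : ∀ i : Fin (n + 2) → ℕ, (∃ e, d - 1 ≤ i e) → p i = 0)
    (hne : ∃ i ∈ indexSet (n + 2) d ((n / 2 + 1) * (d - 2)), p i ≠ 0) :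
    ((periodMatrix (n + 2) d (n / 2 * d - n - 2) d p).rank : ℚ) = movasatiBound n d ∨
      secondGapBound n d ≤ ((periodMatrix (n + 2) d (n / 2 * d - n - 2) d p).rank : ℚ) := by
  have hk : n = 2 * (n / 2) := by obtain ⟨r, hr⟩ := hn; omega
  rcases rank_periodMatrix_eq_or_ciLocusCodim_le hn hn2 hd p hbox hne with h | h
  · left
    have hle : (n / 2 + 1) ^ 2 ≤ (n / 2 + d).choose d := by
      have := DuqueFrancoVillaflor2025.linC_closed_form 0 (n / 2) d (by omega); omega
    have hZ : ((periodMatrix (n + 2) d (n / 2 * d - n - 2) d p).rank : ℤ) = movasatiBound n d := by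
      rw [h, movasatiBound, Nat.cast_sub hle]
    exact_mod_cast hZ
  · right
    have h2 := secondGapBound_eq_ciLocusCodim (n / 2) d (by omega) hd
    rw [← hk] at h2
    rw [h2]
    exact_mod_cast h

/-! ### The second value is attained: the period vector of the pre-final monomial -/

/-- The positions `2, …, n/2+1` of `Fin (n+2)` (the `n/2` exponents `d − 2` of the pre-final monomial).
[cite: Villaflorloyola2021, Proposition 3.3, §7 eq. (7.2)] -/
def preFinalSupport (n : ℕ) : Finset (Fin (n + 2)) :=
  Finset.univ.filter fun e => 2 ≤ (e : ℕ) ∧ (e : ℕ) ≤ n / 2 + 1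

/-- The pre-final exponent `(1, d−3, d−2, …, d−2, 0, …, 0)` on `Fin (n+2)`: position `0 ↦ 1`, `1 ↦ d−3`,
`2,…,n/2+1 ↦ d−2`, the rest `0` — Villaflor's extremal `α = (0,…,0,1,d−3,d−2,…,d−2)` up to relabeling (the socle
monomial of the `(1,…,1,2)` configuration (7.2) `⟨x_0,x_2,…,x_{n−2},x_n², x_odd^{d−1}, x_{n+1}^{d−2}⟩`).
[cite: Villaflorloyola2021, Proposition 3.3, §7 eq. (7.2)] -/
def preFinalExponent (n d : ℕ) : Fin (n + 2) → ℕ :=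
  Function.update (Function.update (fun e => if e ∈ preFinalSupport n then d - 2 else 0)
    (1 : Fin (n + 2)) (d - 3)) (0 : Fin (n + 2)) 1

/-- The period vector of the monomial `x^{preFinal}`: `p_i = [i = preFinal]` (the periods of the dual-basis functional
`coeff_{x^α}`, whose `Ann` is the monomial complete intersection `(x_e^{α_e+1})`).
[cite: Villaflorloyola2021, §7 eq. (7.2)] [cite: Movasati2016Periods, Definition 1] -/
def preFinalVector (n d : ℕ) : (Fin (n + 2) → ℕ) → K := fun i => if i = preFinalExponent n d then 1 else 0

/-- `#{2, …, n/2+1} = n/2` inside `Fin (n+2)` (the `n/2` exponents `d − 2` of the pre-final monomial).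
[cite: Villaflorloyola2021, Proposition 3.3] -/
theorem card_preFinalSupport (n : ℕ) : (preFinalSupport n).card = n / 2 := by
  have himg : (preFinalSupport n).image (fun e : Fin (n + 2) => (e : ℕ)) = Finset.Icc 2 (n / 2 + 1) := by
    ext x
    simp only [preFinalSupport, Finset.mem_image, Finset.mem_filter, Finset.mem_univ, true_and, Finset.mem_Icc]
    constructor
    · rintro ⟨e, ⟨h1, h2⟩, rfl⟩
      exact ⟨h1, h2⟩
    · rintro ⟨h1, h2⟩
      exact ⟨⟨x, by omega⟩, ⟨h1, h2⟩, rfl⟩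
  rw [← Finset.card_image_of_injective _ Fin.val_injective, himg, Nat.card_Icc]
  omega

/-- The pre-final exponent in the shape of the tree's `card_divSet_preFinal`. [cite: Villaflorloyola2021, Proposition 3.3] -/
theorem preFinalExponent_eq_shape (n d : ℕ) :
    preFinalExponent n d = fun e => if e ∈ preFinalSupport n then d - 2
      else if e = (1 : Fin (n + 2)) then d - 2 - 1 else if e = (0 : Fin (n + 2)) then 1 else 0 := by
  funext e
  by_cases he0 : e = 0
  · subst he0
    have h0 : (0 : Fin (n + 2)) ∉ preFinalSupport n := by simp [preFinalSupport]
    simp [preFinalExponent, h0]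
  · by_cases he1 : e = 1
    · subst he1
      have h1 : (1 : Fin (n + 2)) ∉ preFinalSupport n := by simp [preFinalSupport]
      simp only [preFinalExponent, Function.update_of_ne he0, Function.update_self, if_neg h1, if_true]
      omega
    · simp [preFinalExponent, he0, he1]

/-- Every pre-final exponent is `≤ d − 2` (in the box, `d ≥ 3`). [cite: Villaflorloyola2021, §7] -/
theorem preFinalExponent_le (hd : 3 ≤ d) (e : Fin (n + 2)) : preFinalExponent n d e ≤ d - 2 := by
  rw [preFinalExponent_eq_shape]
  dsimp only
  split_ifs <;> omega

/-- `|preFinal| = (n/2)(d−2) + (d−3) + 1 = (n/2+1)(d−2)` (`d ≥ 3`). [cite: Villaflorloyola2021, §7] -/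
theorem sum_preFinalExponent (hd : 3 ≤ d) : ∑ e, preFinalExponent n d e = (n / 2 + 1) * (d - 2) := by
  set g : Fin (n + 2) → ℕ := fun e => if e ∈ preFinalSupport n then d - 2 else 0 with hg
  have h0 : (0 : Fin (n + 2)) ∉ preFinalSupport n := by simp [preFinalSupport]
  have h1 : (1 : Fin (n + 2)) ∉ preFinalSupport n := by simp [preFinalSupport]
  have hsumg : ∑ e, g e = (preFinalSupport n).card * (d - 2) := by
    rw [hg, ← Finset.sum_filter, Finset.filter_mem_eq_inter, Finset.univ_inter, Finset.sum_const, smul_eq_mul]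
  have ha := sum_update_add g 1 (d - 3)
  have hb := sum_update_add (Function.update g 1 (d - 3)) 0 1
  have hg1 : g 1 = 0 := by rw [hg]; exact if_neg h1
  have h01 : (0 : Fin (n + 2)) ≠ 1 := by simp
  have hg0 : Function.update g 1 (d - 3) 0 = 0 := by
    rw [Function.update_of_ne h01, hg]; exact if_neg h0
  rw [hg1] at ha
  rw [hg0] at hb
  rw [card_preFinalSupport] at hsumg
  have hmul : (n / 2 + 1) * (d - 2) = n / 2 * (d - 2) + (d - 2) := by ring
  rw [preFinalExponent, ← hg, hmul]
  omega

/-- `preFinal` is a box exponent of degree `σ = (n/2+1)(d−2)` (`d ≥ 3`). [cite: Villaflorloyola2021, §7] -/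
theorem preFinalExponent_mem_indexSet (hd : 3 ≤ d) :
    preFinalExponent n d ∈ indexSet (n + 2) d ((n / 2 + 1) * (d - 2)) :=
  mem_indexSet.mpr ⟨fun e => by have := preFinalExponent_le hd e; omega, sum_preFinalExponent hd⟩

/-- The divisor count of `preFinal` in column degree `M` is the `(1,…,1,2)` count `ciHilbert(2, d−2, (d−1)^{n/2})(M)`
(tree `card_divSet_preFinal`). [cite: Villaflorloyola2021, Proposition 3.3] [cite: Kloosterman2023, Prop. 3.2] -/
theorem card_divSet_preFinalExponent (hd : 3 ≤ d) (M : ℕ) :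
    (divSet (preFinalExponent n d) M).card = ciHilbert (2 :: (d - 2) :: List.replicate (n / 2) (d - 1)) M := by
  classical
  have h0 : (0 : Fin (n + 2)) ∉ preFinalSupport n := by simp [preFinalSupport]
  have h1 : (1 : Fin (n + 2)) ∉ preFinalSupport n := by simp [preFinalSupport]
  have h01 : (0 : Fin (n + 2)) ≠ 1 := by simp
  rw [preFinalExponent_eq_shape, card_divSet_preFinal (preFinalSupport n) h01 h0 h1 (by omega : 1 ≤ d - 2) M,
    card_preFinalSupport, show d - 2 + 1 = d - 1 by omega]

open Classical in
/-- For the dual-basis functional `ℓ = coeff_α` the standard exponents (any monomial order) are exactly the divisors of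
`α`, so `HF_{Ann coeff_α}(M) = #S^M_α` (Macaulay's count for the monomial ideal `Ann coeff_α = (x^β : x^β ∤ x^α)`).
[cite: Villaflorloyola2021, Proposition 3.1, Remark 3.1] -/
theorem hilbert_annIdeal_lcoeff_eq_card_divSet (mo : MonomialOrder (Fin m)) (α : Fin m →₀ ℕ) (M : ℕ) :
    finrank K (homogeneousSubmodule (Fin m) K M) -
        finrank K (idealDegree (annIdeal (lcoeff K α : MvPolynomial (Fin m) K →ₗ[K] K)) M) =
      (divSet (⇑α) M).card := by
  have hℓ : ∀ q, (lcoeff K α : MvPolynomial (Fin m) K →ₗ[K] K) (homogeneousComponent (α.degree) q) =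
      lcoeff K α q := fun q => by
    simp [lcoeff_apply, coeff_homogeneousComponent]
  rw [hilbert_annIdeal_eq_card_standard mo (lcoeff K α) hℓ M]
  -- standard exponents of `Ann(coeff_α)` = divisors of `α`
  have hstd : ∀ β : Fin m →₀ ℕ,
      β ∉ leadingExponents mo (annIdeal (lcoeff K α : MvPolynomial (Fin m) K →ₗ[K] K)) ↔ β ≤ α := by
    intro β
    constructor
    · intro hβ
      by_contra hle
      refine hβ ⟨monomial β 1, ?_, monomial_eq_zero.not.mpr one_ne_zero, ?_⟩
      · rw [mem_annIdeal_iff]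
        intro h
        rw [lcoeff_apply, coeff_monomial_mul', if_neg hle]
      · rw [MonomialOrder.degree_monomial, if_neg one_ne_zero]
    · rintro hle ⟨f, hf, hf0, hdeg⟩
      have h := (mem_annIdeal_iff.mp hf) (monomial (α - β) 1)
      rw [lcoeff_apply, coeff_mul_monomial', if_pos tsub_le_self, tsub_tsub_cancel_of_le hle, mul_one, ← hdeg]
        at h
      exact hf0 (mo.leadingCoeff_eq_zero_iff.mp h)
  refine Finset.card_nbij' (fun β => ⇑β) (fun j => Finsupp.equivFunOnFinite.symm j) (fun β hβ => ?_)
    (fun j hj => ?_) (fun β _ => Finsupp.equivFunOnFinite_symm_coe β) (fun j _ => Finsupp.coe_equivFunOnFinite_symm j)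
  · obtain ⟨hsum, hβ⟩ := Finset.mem_filter.mp (Finset.mem_coe.mp hβ)
    rw [Literature.RingTheory.MvPolynomial.mem_finsuppAntidiag_univ_iff, Finsupp.degree_eq_sum] at hsum
    rw [Finset.mem_coe, mem_divSet]
    exact ⟨fun e => (hstd β).mp hβ e, hsum⟩
  · obtain ⟨hle, hsum⟩ := mem_divSet.mp (Finset.mem_coe.mp hj)
    rw [Finset.mem_coe, Finset.mem_filter, Literature.RingTheory.MvPolynomial.mem_finsuppAntidiag_univ_iff,
      Finsupp.degree_eq_sum]
    exact ⟨by simpa using hsum, (hstd _).mpr fun e => by simpa using hle e⟩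

/-- **The `(1,…,1,2)` value is attained** by the period vector of the pre-final monomial:
`rank [p_{i+j}(preFinal)] = ciLocusCodim (1^{n/2}, 2) d` (`n = 2k ≥ 2`, `d ≥ 4`; any field) — the second value of
Theorem 1.3 is a value ("the ones associated to a complete intersection cycle of type `(1,1,…,1,2)` attain the
minimal possible codimension"). [cite: Villaflorloyola2021, Theorem 1.3, §7 eq. (7.2)] [cite: Kloosterman2023, Prop. 3.2] -/
theorem rank_periodMatrix_preFinalVector (hn : Even n) (hn2 : 2 ≤ n) (hd : 4 ≤ d) :
    (periodMatrix (n + 2) d (n / 2 * d - n - 2) d (preFinalVector n d : (Fin (n + 2) → ℕ) → K)).rank =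
      ciLocusCodim (List.replicate (n / 2) 1 ++ [2]) d := by
  classical
  have hk : n = 2 * (n / 2) := by obtain ⟨r, hr⟩ := hn; omega
  have hN : n + 2 ≤ n / 2 * d := by
    have : n / 2 * 4 ≤ n / 2 * d := Nat.mul_le_mul_left _ hd
    omega
  have hdeg := deg_add_rowDeg' hk hN
  set α : Fin (n + 2) →₀ ℕ := Finsupp.equivFunOnFinite.symm (preFinalExponent n d) with hαdef
  have hαcoe : (⇑α : Fin (n + 2) → ℕ) = preFinalExponent n d := Finsupp.coe_equivFunOnFinite_symm _
  have hαdeg : α.degree = d + (n / 2 * d - n - 2) := by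
    rw [hdeg, Finsupp.degree_eq_sum, hαcoe]
    exact sum_preFinalExponent (by omega)
  set ℓ : MvPolynomial (Fin (n + 2)) K →ₗ[K] K := lcoeff K α with hℓdef
  have hℓ : ∀ q, ℓ (homogeneousComponent (d + (n / 2 * d - n - 2)) q) = ℓ q := fun q => by
    rw [hℓdef, lcoeff_apply, lcoeff_apply, coeff_homogeneousComponent, if_pos hαdeg]
  have hbox : ∀ s : Fin (n + 2) →₀ ℕ, (∃ e, d - 1 ≤ s e) → ℓ (monomial s 1) = 0 := by
    rintro s ⟨e, he⟩
    have hsα : s ≠ α := by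
      intro hsα
      have h1 := preFinalExponent_le (n := n) (by omega : 3 ≤ d) e
      rw [← hαcoe, ← hsα] at h1
      omega
    rw [hℓdef, lcoeff_apply, coeff_monomial, if_neg hsα]
  have hp : ∀ i : Fin (n + 2) → ℕ, (preFinalVector n d : (Fin (n + 2) → ℕ) → K) i =
      ℓ (monomial (Finsupp.equivFunOnFinite.symm i) 1) := by
    intro i
    by_cases hi : i = preFinalExponent n d
    · subst hi
      simp [preFinalVector, hℓdef, hαdef, lcoeff_apply, coeff_monomial]
    · have hne : Finsupp.equivFunOnFinite.symm i ≠ α := fun h =>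
        hi (Finsupp.equivFunOnFinite.symm.injective (h.trans hαdef))
      simp [preFinalVector, hi, hℓdef, lcoeff_apply, coeff_monomial, hne]
  rw [rank_periodMatrix_eq_hilbert_of_eq ℓ hbox hℓ rfl hp, hℓdef,
    hilbert_annIdeal_lcoeff_eq_card_divSet MonomialOrder.degLex α d, hαcoe,
    card_divSet_preFinalExponent (by omega) d, ciHilbert_preFinal_eq_ciLocusCodim (n / 2) d (by omega)]

/-- `preFinalVector` is an admissible period vector: zero off the box, non-zero on `I_σ` (`d ≥ 3`).
[cite: Villaflorloyola2021, §7] [cite: Movasati2016Periods, Definition 1] -/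
theorem preFinalVector_admissible (hd : 3 ≤ d) :
    (∀ i : Fin (n + 2) → ℕ, (∃ e, d - 1 ≤ i e) → (preFinalVector n d : (Fin (n + 2) → ℕ) → K) i = 0) ∧
      ∃ i ∈ indexSet (n + 2) d ((n / 2 + 1) * (d - 2)), (preFinalVector n d : (Fin (n + 2) → ℕ) → K) i ≠ 0 := by
  refine ⟨fun i hi => ?_, ⟨preFinalExponent n d, preFinalExponent_mem_indexSet hd, by simp [preFinalVector]⟩⟩
  obtain ⟨e, he⟩ := hi
  rw [preFinalVector, if_neg]
  rintro rfl
  have := preFinalExponent_le (n := n) hd e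
  omega

/-- `Σ` over `List.range` is the `Finset.range` sum. [folklore] -/
private theorem sum_map_range' (f : ℕ → ℕ) (n : ℕ) :
    ((List.range n).map f).sum = ∑ a ∈ Finset.range n, f a := by
  induction n with
  | zero => simp
  | succ n ih => rw [List.range_succ, List.map_append, List.sum_append, ih, Finset.sum_range_succ]; simp

/-- One term of the peeling recursion bounds the count below: `h(a :: R; M) ≥ h(R; M − j)` for `j < a`, `j ≤ M`.
[cite: Kloosterman2023, §2 eq. (1)] -/
theorem ciHilbert_le_ciHilbert_cons (a : ℕ) (R : List ℕ) {M j : ℕ} (hj : j < a) (hjM : j ≤ M) :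
    ciHilbert R (M - j) ≤ ciHilbert (a :: R) M := by
  rw [ciHilbert_cons, sum_map_range']
  have h := Finset.single_le_sum (f := fun i => if i ≤ M then ciHilbert R (M - i) else 0)
    (fun i _ => Nat.zero_le _) (Finset.mem_range.mpr hj)
  simp only [if_pos hjM] at h
  exact h

/-- The box count is positive up to the socle: `ciHilbert((c+1)^k)(M) ≥ 1` for `M ≤ k·c` (tree `card_box_pos_iff`).
[cite: Kloosterman2025, Lemma 2.1] -/
theorem one_le_ciHilbert_replicate {k c M : ℕ} (hM : M ≤ k * c) : 1 ≤ ciHilbert (List.replicate k (c + 1)) M := by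
  classical
  have h1 := card_box_eq_ciHilbert (Finset.univ : Finset (Fin k)) (e := c + 1) (by omega) M
  have h2 := (card_box_pos_iff (Finset.univ : Finset (Fin k)) (e := c + 1) (by omega) M).mpr
  rw [Finset.card_univ, Fintype.card_fin] at h1 h2
  rw [← h1]
  exact h2 (by simpa using hM)

/-- The two values of Theorem 1.3 are distinct when `d ≥ max{4, 2 + 6/n}` (`d + 1 ≤ σ`; at `(n,d) = (2,4)` both equal
`1`): `C(n/2+d,d) − (n/2+1)² < ciLocusCodim (1^{n/2}, 2) d`. [cite: Villaflorloyola2021, Theorem 1.3, Remark 4.1] -/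
theorem choose_sub_sq_lt_ciLocusCodim (hn2 : 2 ≤ n) (hd : 4 ≤ d) (hσ : d + 1 ≤ (n / 2 + 1) * (d - 2)) :
    (n / 2 + d).choose d - (n / 2 + 1) ^ 2 < ciLocusCodim (List.replicate (n / 2) 1 ++ [2]) d := by
  have hsplit := ciHilbert_secondGap_split (d - 2) (by omega) (List.replicate (n / 2) (d - 1))
  rw [show d - 2 + 1 = d - 1 by omega, show d - 2 + 2 = d by omega, show d - 2 - 1 = d - 3 by omega,
    ← List.replicate_succ, ciHilbert_replicate_eq_choose_sub_sq (n / 2) (by omega : 3 ≤ d)] at hsplit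
  rw [← ciHilbert_preFinal_eq_ciLocusCodim (n / 2) d (by omega), ← hsplit]
  have hpos : 1 ≤ ciHilbert ((d - 3) :: List.replicate (n / 2) (d - 1)) (d - 1) := by
    refine le_trans ?_ (ciHilbert_le_ciHilbert_cons (d - 3) _ (j := d - 4) (by omega) (by omega))
    rw [show d - 1 - (d - 4) = 3 by omega, show d - 1 = d - 2 + 1 by omega]
    refine one_le_ciHilbert_replicate ?_
    have : (n / 2 + 1) * (d - 2) = n / 2 * (d - 2) + (d - 2) := by ring
    omega
  omega

/-- **The second least rank** (companion of the tree's `Movasati2017.isLeast_rank_periodMatrix`): for the Fermat `n`-fold,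
`n = 2k ≥ 2`, `d ≥ max{4, 2 + 6/n}`, over any field, `ciLocusCodim (1^{n/2}, 2) d =
C(n/2+d,d) + C(n/2+d−1,d−1) − (3n²/8 + 9n/4 + 2)` is the LEAST rank of `[p_{i+j}]` over the admissible period vectors
whose rank is not Movasati's `C(n/2+d,d) − (n/2+1)²` — "the components of smallest codimension not satisfying (igualdad1)
… the ones associated to a complete intersection cycle of type `(1,1,…,1,2)` attain the minimal possible codimension", at
the tangent level. [cite: Villaflorloyola2021, Theorem 1.3] [cite: Movasati2017GMCD, Theorem 2] -/
theorem isLeast_rank_periodMatrix_ne_movasati (hn : Even n) (hn2 : 2 ≤ n) (hd : 4 ≤ d)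
    (hσ : d + 1 ≤ (n / 2 + 1) * (d - 2)) :
    IsLeast {r : ℕ | r ≠ (n / 2 + d).choose d - (n / 2 + 1) ^ 2 ∧
        ∃ p : (Fin (n + 2) → ℕ) → K, (∀ i : Fin (n + 2) → ℕ, (∃ e, d - 1 ≤ i e) → p i = 0) ∧
          (∃ i ∈ indexSet (n + 2) d ((n / 2 + 1) * (d - 2)), p i ≠ 0) ∧
          (periodMatrix (n + 2) d (n / 2 * d - n - 2) d p).rank = r}
      (ciLocusCodim (List.replicate (n / 2) 1 ++ [2]) d) := by
  refine ⟨⟨(choose_sub_sq_lt_ciLocusCodim hn2 hd hσ).ne', preFinalVector n d,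
    (preFinalVector_admissible (K := K) (n := n) (by omega)).1, (preFinalVector_admissible (by omega)).2,
    rank_periodMatrix_preFinalVector hn hn2 hd⟩, ?_⟩
  rintro r ⟨hr, p, hbox, hne, rfl⟩
  rcases rank_periodMatrix_eq_or_ciLocusCodim_le hn hn2 hd p hbox hne with h | h
  · exact absurd h hr
  · exact h

end PeriodMatrix

/-! ## All column degrees: the whole Hilbert function of `J^{F,λ}` lies above the `(1,…,1,2)` one -/

section AllDegrees

variable {τ : Type*} [Fintype τ] [DecidableEq τ]

/-- `h(a; 0) = 1` for a degree vector with positive entries (only the empty monomial). [cite: Kloosterman2023, §2 eq. (1)] -/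
theorem ciHilbert_at_zero {a : List ℕ} (h : ∀ x ∈ a, 1 ≤ x) : ciHilbert a 0 = 1 := by
  induction a with
  | nil => rfl
  | cons x R ih =>
    rw [ciHilbert_cons, sum_map_range']
    have hx : 1 ≤ x := h x (by simp)
    have hterm : ∀ j ∈ Finset.range x,
        (if j ≤ 0 then ciHilbert R (0 - j) else 0) = if j = 0 then ciHilbert R 0 else 0 := by
      intro j _
      by_cases hj : j = 0
      · subst hj; simp
      · rw [if_neg (by omega), if_neg hj]
    rw [Finset.sum_congr rfl hterm, Finset.sum_ite_eq' (Finset.range x) 0 (fun _ => ciHilbert R 0),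
      if_pos (Finset.mem_range.mpr (by omega)), ih (fun y hy => h y (List.mem_cons_of_mem x hy))]

/-- The numerical identity of Case 2 in EVERY column degree `M ≥ 1` (`c ≥ 2`):
`ciHilbert((c+1) :: R)(M) + ciHilbert((c−1) :: R)(M−1) = ciHilbert(2 :: c :: R)(M)` — in divisor counts,
`#S^M_{((d−2)^{k+1})} + #S^{M−1}_{(d−4,(d−2)^k)} = #S^M_{(1,d−3,(d−2)^k)}`. [cite: Villaflorloyola2021, §7 Case 2.1]
[cite: Kloosterman2023, §2 eq. (1)] -/
theorem ciHilbert_secondGap_split_all (c : ℕ) (hc : 2 ≤ c) (R : List ℕ) {M : ℕ} (hM : 1 ≤ M) :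
    ciHilbert ((c + 1) :: R) M + ciHilbert ((c - 1) :: R) (M - 1) = ciHilbert (2 :: c :: R) M := by
  have h1 := ciHilbert_succ_cons' c R M
  have h2 := ciHilbert_succ_cons' (c - 1) R (M - 1)
  rw [show c - 1 + 1 = c by omega] at h2
  have h3 := ciHilbert_succ_cons' 1 (c :: R) M
  rw [show (1 : ℕ) + 1 = 2 from rfl, if_pos hM, ciHilbert_one_cons] at h3
  by_cases hcM : c ≤ M
  · rw [if_pos hcM] at h1
    rw [if_pos (by omega), show M - 1 - (c - 1) = M - c by omega] at h2
    omega
  · rw [if_neg hcM] at h1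
    rw [if_neg (by omega)] at h2
    omega

open MvPolynomial Module Movasati2016 Literature.RingTheory.MvPolynomial Literature.AlgebraicGeometry.Kloosterman2025

attribute [local instance] MvPolynomial.gradedAlgebra

variable {K : Type*} [Field K] {m d : ℕ}

open Classical in
/-- **Theorem 1.3 (desteo2) in every column degree** (same proof; the printed statement is the case `M = d`): under the
hypotheses of `secondGap_le_hilbert_annIdeal` — `ℓ ≠ 0` concentrated in degree `(k+1)(d−2)`, `d ≥ 4`, killing `J^F`, and
`HF_{Ann ℓ}(d) ≠ C(k+d,d) − (k+1)²` — the WHOLE Hilbert function of `Ann ℓ` dominates that of the complete intersection of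
type `(2, d−2, (d−1)^k)` (the leading-term ideal (7.2) of the extremal configuration):
`HF_{Ann ℓ}(M) ≥ ciHilbert(2, d−2, (d−1)^k)(M)` for every `M`; equivalently every period matrix `[p_{i+j}]_{I_N × I_M}`,
`M + N = σ`, has at least that rank. [cite: Villaflorloyola2021, Theorem 1.3, §7 (proof), Proposition 3.3] -/
theorem secondGap_le_hilbert_annIdeal_all {k : ℕ} (hd : 4 ≤ d) (ℓ : MvPolynomial (Fin m) K →ₗ[K] K)
    (hbox : ∀ s : Fin m →₀ ℕ, (∃ e, d - 1 ≤ s e) → ℓ (monomial s 1) = 0)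
    {t : ℕ} (hℓ : ∀ q, ℓ (homogeneousComponent t q) = ℓ q) (ht : t = (k + 1) * (d - 2)) (hne : ℓ ≠ 0)
    (hneq : finrank K (homogeneousSubmodule (Fin m) K d) - finrank K (idealDegree (annIdeal ℓ) d) ≠
      (k + d).choose d - (k + 1) ^ 2) (M : ℕ) :
    ciHilbert (2 :: (d - 2) :: List.replicate k (d - 1)) M ≤
      finrank K (homogeneousSubmodule (Fin m) K M) - finrank K (idealDegree (annIdeal ℓ) M) := by
  set mo : MonomialOrder (Fin m) := MonomialOrder.degLex with hmo
  set LE := leadingExponents mo (annIdeal ℓ) with hLEdef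
  have hup : IsUpperSet LE := isUpperSet_leadingExponents mo _
  set std : ℕ → Finset (Fin m →₀ ℕ) := fun u =>
    ((univ : Finset (Fin m)).finsuppAntidiag u).filter fun a => a ∉ LE with hstd
  have hmem_std : ∀ u (β : Fin m →₀ ℕ), β ∈ std u ↔ (∑ i, β i = u) ∧ β ∉ LE := by
    intro u β
    rw [hstd, Finset.mem_filter, Literature.RingTheory.MvPolynomial.mem_finsuppAntidiag_univ_iff,
      Finsupp.degree_eq_sum]
  have hHF : ∀ u, finrank K (homogeneousSubmodule (Fin m) K u) - finrank K (idealDegree (annIdeal ℓ) u) =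
      (std u).card := fun u => hilbert_annIdeal_eq_card_standard mo ℓ hℓ u
  obtain ⟨α, hαsum, hαE, hαbox⟩ := exists_standard_socle mo ℓ hbox hℓ hne
  by_cases hmid : ∃ e, 0 < α e ∧ α e < d - 2
  · exact ciHilbert_preFinal_le_hilbert_annIdeal mo ℓ hbox hℓ ht hαsum hαE hmid M
  push Not at hmid
  have hconc : ∀ e, α e = 0 ∨ α e = d - 2 := fun e => by
    have h1 := hmid e; have h2 := hαbox e
    by_cases h0 : α e = 0
    · exact Or.inl h0
    · exact Or.inr (le_antisymm h2 (h1 (Nat.pos_of_ne_zero h0)))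
  set F : Finset (Fin m) := univ.filter fun e => α e = d - 2 with hF
  have hαF : (⇑α : Fin m → ℕ) = fun e => if e ∈ F then d - 2 else 0 := by
    funext e
    by_cases he : e ∈ F
    · rw [if_pos he]; simpa [hF] using he
    · rw [if_neg he]
      have hne' : α e ≠ d - 2 := by simpa [hF] using he
      rcases hconc e with h0 | h2
      · exact h0
      · exact absurd h2 hne'
  have hcardF : F.card = k + 1 := by
    have h1 : ∑ e, (⇑α) e = F.card * (d - 2) := by
      rw [hαF, ← Finset.sum_filter, Finset.filter_mem_eq_inter, Finset.univ_inter, Finset.sum_const, smul_eq_mul]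
    rw [hαsum, ht] at h1
    exact (Nat.eq_of_mul_eq_mul_right (by omega) h1).symm
  have hdiv : ∀ β : Fin m →₀ ℕ, β ≤ α → β ∉ LE := fun β hβ hβE => hαE (hup hβ hβE)
  have hstd_box : ∀ β : Fin m →₀ ℕ, β ∉ LE → ∀ e, β e ≤ d - 2 := by
    intro β hβ e
    by_contra h
    push Not at h
    refine hβ ⟨monomial β 1, Movasati2017.monomial_mem_annIdeal_of_le ℓ hbox ⟨e, by omega⟩,
      monomial_eq_zero.not.mpr one_ne_zero, ?_⟩
    rw [MonomialOrder.degree_monomial, if_neg one_ne_zero]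
  have hexists : ∀ u, (divSet (⇑α) u).card < (std u).card →
      ∃ β : Fin m →₀ ℕ, (∑ i, β i = u) ∧ β ∉ LE ∧ ∃ w, w ∉ F ∧ 1 ≤ β w := by
    intro u hlt
    have himg : ((divSet (⇑α) u).image fun j => Finsupp.equivFunOnFinite.symm j).card < (std u).card := by
      rwa [Finset.card_image_of_injective _ Finsupp.equivFunOnFinite.symm.injective]
    obtain ⟨β, hβstd, hβnot⟩ := Finset.exists_mem_notMem_of_card_lt_card himg
    obtain ⟨hβsum, hβE⟩ := (hmem_std u β).mp hβstd
    have hnotle : ¬ β ≤ α := by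
      intro hle
      refine hβnot (Finset.mem_image.mpr ⟨⇑β, mem_divSet.mpr ⟨fun e => hle e, hβsum⟩, ?_⟩)
      exact Finsupp.equivFunOnFinite_symm_coe β
    obtain ⟨w, hw⟩ : ∃ w, α w < β w := by
      by_contra h
      push Not at h
      exact hnotle fun e => h e
    have hαw : α w = 0 := by
      have := hstd_box β hβE w
      rcases hconc w with h0 | h2
      · exact h0
      · omega
    refine ⟨β, hβsum, hβE, w, ?_, by omega⟩
    simp only [hF, Finset.mem_filter, Finset.mem_univ, true_and]
    omega
  have hcount_d : (divSet (⇑α) d).card = ciHilbert (List.replicate (k + 1) (d - 1)) d := by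
    rw [hαF, card_divSet_indicator, hcardF, show d - 2 + 1 = d - 1 by omega]
  have hle_d : (divSet (⇑α) d).card ≤ (std d).card := by
    rw [← hHF]; exact card_divSet_le_hilbert_annIdeal_of_notMem mo ℓ hℓ hαE d
  have hlt_d : (divSet (⇑α) d).card < (std d).card := by
    rcases hle_d.eq_or_lt with h | h
    · exfalso
      apply hneq
      rw [hHF d, ← h, hcount_d, ciHilbert_replicate_eq_choose_sub_sq k (by omega)]
    · exact h
  obtain ⟨μ, -, hμE, v, hvF, hμv⟩ := hexists d hlt_d
  have hstd1 : k + 2 ≤ (std 1).card := by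
    have hinj : Function.Injective fun e : Fin m => Finsupp.single e (1 : ℕ) :=
      Finsupp.single_left_injective one_ne_zero
    have hsub : (insert v F).image (fun e => Finsupp.single e (1 : ℕ)) ⊆ std 1 := by
      intro β hβ
      obtain ⟨e, he, rfl⟩ := Finset.mem_image.mp hβ
      rw [hmem_std]
      refine ⟨by simp, ?_⟩
      rcases Finset.mem_insert.mp he with rfl | heF
      · exact fun hin => hμE (hup (Finsupp.single_le_iff.mpr hμv) hin)
      · have hαe : α e = d - 2 := by simpa [hF] using heF
        exact hdiv _ (Finsupp.single_le_iff.mpr (by rw [hαe]; omega))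
    calc k + 2 = (insert v F).card := by rw [Finset.card_insert_of_notMem hvF, hcardF]
      _ = ((insert v F).image fun e => Finsupp.single e (1 : ℕ)).card :=
          (Finset.card_image_of_injective _ hinj).symm
      _ ≤ (std 1).card := Finset.card_le_card hsub
  have ht2 : 2 ≤ t := by
    rw [ht]
    calc 2 ≤ d - 2 := by omega
      _ = 1 * (d - 2) := (one_mul _).symm
      _ ≤ (k + 1) * (d - 2) := Nat.mul_le_mul_right _ (by omega)
  have hsymm := hilbert_annIdeal_symm (σ := Fin m) hℓ (a := 1) (b := t - 1) (by omega)
  have hval : (divSet (⇑α) (t - 1)).card = k + 1 := by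
    rw [hαF, card_divSet_indicator, hcardF, ht]
    exact (ciHilbert_replicate_one_and_sub_one k (c := d - 2) (by omega)).2
  have hlt_t : (divSet (⇑α) (t - 1)).card < (std (t - 1)).card := by
    rw [hval, ← hHF (t - 1), ← hsymm, hHF 1]
    omega
  obtain ⟨β, hβsum, hβE, w, hwF, hβw⟩ := hexists (t - 1) hlt_t
  have hβbox := hstd_box β hβE
  have hαw0 : α w = 0 := by
    have h := congr_fun hαF w
    simp only [if_neg hwF] at h
    exact h
  -- the degree-`M` bound: `#S^M_α ≤ HF(M)` always (this settles `M = 0`)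
  have hαM : (divSet (⇑α) M).card ≤ (std M).card := by
    rw [← hHF]; exact card_divSet_le_hilbert_annIdeal_of_notMem mo ℓ hℓ hαE M
  have hcount_M : (divSet (⇑α) M).card = ciHilbert (List.replicate (k + 1) (d - 1)) M := by
    rw [hαF, card_divSet_indicator, hcardF, show d - 2 + 1 = d - 1 by omega]
  by_cases hM0 : M = 0
  · subst hM0
    rw [hHF 0, ciHilbert_at_zero (fun x hx => by
      simp only [List.mem_cons, List.mem_replicate] at hx; omega)]
    rw [ciHilbert_at_zero (fun x hx => by simp only [List.mem_replicate] at hx; omega)] at hcount_M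
    omega
  have hM1 : 1 ≤ M := Nat.pos_of_ne_zero hM0
  -- degree-`M` divisors of `x^β` through `x_w`
  set D : Finset (Fin m → ℕ) := (divSet (⇑β) M).filter fun j => 1 ≤ j w with hD
  have hsum_le : (divSet (⇑α) M).card + D.card ≤ (std M).card := by
    have hdisj : Disjoint (divSet (⇑α) M) D := by
      rw [Finset.disjoint_left]
      intro j hjα hjD
      have h1 : j w ≤ α w := (mem_divSet.mp hjα).1 w
      have h2 := (Finset.mem_filter.mp hjD).2
      omega
    rw [← Finset.card_union_of_disjoint hdisj]
    refine Finset.card_le_card_of_injOn (fun j => Finsupp.equivFunOnFinite.symm j) (fun j hj => ?_)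
      (fun _ _ _ _ h => Finsupp.equivFunOnFinite.symm.injective h)
    rw [Finset.mem_coe, hmem_std]
    rcases Finset.mem_union.mp (Finset.mem_coe.mp hj) with hj | hj
    · obtain ⟨hle, hs⟩ := mem_divSet.mp hj
      exact ⟨by simpa using hs, hdiv _ fun e => by simpa using hle e⟩
    · obtain ⟨hj, -⟩ := Finset.mem_filter.mp hj
      obtain ⟨hle, hs⟩ := mem_divSet.mp hj
      exact ⟨by simpa using hs, fun hin => hβE (hup (show Finsupp.equivFunOnFinite.symm j ≤ β from
        fun e => by simpa using hle e) hin)⟩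
  set κ : Fin m → ℕ := Function.update (⇑β) w (β w - 1) with hκ
  have hκw : κ w = β w - 1 := by simp [hκ]
  have hκne : ∀ e, e ≠ w → κ e = β e := fun e he => by simp [hκ, he]
  have hDcard : D.card = (divSet κ (M - 1)).card := by
    refine Finset.card_nbij' (fun j => Function.update j w (j w - 1)) (fun g => Function.update g w (g w + 1))
      (fun j hj => ?_) (fun g hg => ?_) (fun j hj => ?_) (fun g hg => ?_)
    · obtain ⟨hj, hjw⟩ := Finset.mem_filter.mp (Finset.mem_coe.mp hj)
      obtain ⟨hle, hs⟩ := mem_divSet.mp hj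
      rw [Finset.mem_coe, mem_divSet]
      refine ⟨fun e => ?_, ?_⟩
      · dsimp only
        by_cases hew : e = w
        · rw [hew, Function.update_self, hκw]; have := hle w; omega
        · rw [Function.update_of_ne hew, hκne e hew]; exact hle e
      · dsimp only
        have h := sum_update_add j w (j w - 1)
        omega
    · obtain ⟨hle, hs⟩ := mem_divSet.mp (Finset.mem_coe.mp hg)
      rw [Finset.mem_coe, Finset.mem_filter, mem_divSet]
      refine ⟨⟨fun e => ?_, ?_⟩, by simp⟩
      · dsimp only
        by_cases hew : e = w
        · rw [hew, Function.update_self]; have := hle w; rw [hκw] at this; omega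
        · rw [Function.update_of_ne hew]; have := hle e; rwa [hκne e hew] at this
      · dsimp only
        have h := sum_update_add g w (g w + 1)
        omega
    · obtain ⟨-, hjw⟩ := Finset.mem_filter.mp (Finset.mem_coe.mp hj)
      funext e
      dsimp only
      by_cases hew : e = w
      · rw [hew, Function.update_self, Function.update_self]; omega
      · rw [Function.update_of_ne hew, Function.update_of_ne hew]
    · funext e
      dsimp only
      by_cases hew : e = w
      · rw [hew, Function.update_self, Function.update_self]; omega
      · rw [Function.update_of_ne hew, Function.update_of_ne hew]
  have hκle : ∀ e, κ e ≤ d - 2 := fun e => by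
    by_cases hew : e = w
    · subst hew; rw [hκw]; have := hβbox e; omega
    · rw [hκne e hew]; exact hβbox e
  have hκsum : ∑ e, κ e + 2 = (k + 1) * (d - 2) := by
    have h := sum_update_add (⇑β) w (β w - 1)
    rw [← ht]
    change ∑ e, κ e + β w = ∑ e, (⇑β) e + (β w - 1) at h
    omega
  have hgreedy := ciHilbert_sub_two_le_card_divSet (c := d - 2) (k := k) (by omega) hκle hκsum (M - 1)
  rw [show d - 2 - 1 = d - 3 by omega, show d - 2 + 1 = d - 1 by omega] at hgreedy
  have hsplit := ciHilbert_secondGap_split_all (d - 2) (by omega) (List.replicate k (d - 1)) hM1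
  rw [show d - 2 + 1 = d - 1 by omega, show d - 2 - 1 = d - 3 by omega] at hsplit
  rw [← hsplit, hHF M]
  have e1 : ciHilbert ((d - 1) :: List.replicate k (d - 1)) M = (divSet (⇑α) M).card := by
    rw [hcount_M, List.replicate_succ]
  omega

/-- The gap in every column degree, rank form (`m` variables, `d ≥ 4`, `d + N = (k+1)(d−2)`): for an admissible period
vector `p`, either `rank [p_{i+j}]_{I_N × I_d}` is Movasati's value, or EVERY `[p_{i+j}]_{I_{N'} × I_M}` with
`M + N' = d + N` has rank `≥ ciHilbert(2, d−2, (d−1)^k)(M)`. [cite: Villaflorloyola2021, Theorem 1.3]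
[cite: Movasati2016Periods, Definition 1, Theorem 6] -/
theorem rank_periodMatrix_eq_or_secondGap_le_all {k N : ℕ} (hd : 4 ≤ d) (hN : d + N = (k + 1) * (d - 2))
    (p : (Fin m → ℕ) → K) (hbox : ∀ i : Fin m → ℕ, (∃ e, d - 1 ≤ i e) → p i = 0)
    (hne : ∃ i ∈ indexSet m d (d + N), p i ≠ 0) :
    (periodMatrix m d N d p).rank = (k + d).choose d - (k + 1) ^ 2 ∨
      ∀ M N' : ℕ, M + N' = d + N →
        ciHilbert (2 :: (d - 2) :: List.replicate k (d - 1)) M ≤ (periodMatrix m d N' M p).rank := by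
  classical
  set ℓ := vectorFunctional m (d + N) p with hℓdef
  have hbox' : ∀ s : Fin m →₀ ℕ, (∃ e, d - 1 ≤ s e) → ℓ (monomial s 1) = 0 := by
    intro s hs
    rw [hℓdef, vectorFunctional_monomial]
    split_ifs
    · exact hbox _ hs
    · rfl
  have hℓ : ∀ q, ℓ (homogeneousComponent (d + N) q) = ℓ q := vectorFunctional_homogeneousComponent _ p
  have hne' : ℓ ≠ 0 := by
    obtain ⟨i, hi, hpi⟩ := hne
    intro h0
    apply hpi
    have h1 := periodVector_vectorFunctional (d + N) p (mem_indexSet.mp hi).2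
    rw [← h1, periodVector, ← hℓdef, h0, LinearMap.zero_apply]
  by_cases h : finrank K (homogeneousSubmodule (Fin m) K d) - finrank K (idealDegree (annIdeal ℓ) d) =
      (k + d).choose d - (k + 1) ^ 2
  · left
    rw [← periodMatrix_vectorFunctional rfl p, ← hℓdef, rank_periodMatrix_eq_hilbert ℓ hbox' hℓ rfl, h]
  · right
    intro M N' hMN
    rw [← periodMatrix_vectorFunctional hMN p, ← hℓdef, rank_periodMatrix_eq_hilbert ℓ hbox' hℓ hMN]
    exact secondGap_le_hilbert_annIdeal_all hd ℓ hbox' hℓ hN hne' h M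

end AllDegrees

/-! ## The census rows (numerical instances) -/

section CensusRows

open Movasati2016

variable {K : Type*} [Field K]

/-- **Quartic fourfolds `(n,d) = (4,4)`**: every admissible period vector has `rank [p_{i+j}] = 6` (linear `ℙ²`) or
`rank ≥ 8` (quadric surface, `CI(1,1,2)`; Movasati: "`Σ_{1,1,2}` has codimension `8`") — rank `7` does not occur.
[cite: Villaflorloyola2021, Theorem 1.3] [cite: Movasati2016Periods, §6] -/
theorem rank_periodMatrix_quarticFourfold_eq_six_or_eight_le (p : (Fin 6 → ℕ) → K)
    (hbox : ∀ i : Fin 6 → ℕ, (∃ e, 3 ≤ i e) → p i = 0) (hne : ∃ i ∈ indexSet 6 4 6, p i ≠ 0) :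
    (periodMatrix 6 4 2 4 p).rank = 6 ∨ 8 ≤ (periodMatrix 6 4 2 4 p).rank := by
  have h := rank_periodMatrix_eq_or_ciLocusCodim_le (n := 4) (d := 4) (by decide) (by norm_num) (by norm_num) p
    hbox hne
  have hv : ciLocusCodim (List.replicate (4 / 2) 1 ++ [2]) 4 = 8 := by decide
  have hc : (4 / 2 + 4).choose 4 - (4 / 2 + 1) ^ 2 = 6 := by decide
  rw [hv, hc] at h
  exact h

/-- **Quintic fourfolds `(4,5)`**: `rank = 12` or `rank ≥ 19`. [cite: Villaflorloyola2021, Theorem 1.3] -/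
theorem rank_periodMatrix_quinticFourfold_eq_or_le (p : (Fin 6 → ℕ) → K)
    (hbox : ∀ i : Fin 6 → ℕ, (∃ e, 4 ≤ i e) → p i = 0) (hne : ∃ i ∈ indexSet 6 5 9, p i ≠ 0) :
    (periodMatrix 6 5 4 5 p).rank = 12 ∨ 19 ≤ (periodMatrix 6 5 4 5 p).rank := by
  have h := rank_periodMatrix_eq_or_ciLocusCodim_le (n := 4) (d := 5) (by decide) (by norm_num) (by norm_num) p
    hbox hne
  have hv : ciLocusCodim (List.replicate (4 / 2) 1 ++ [2]) 5 = 19 := by decide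
  have hc : (4 / 2 + 5).choose 5 - (4 / 2 + 1) ^ 2 = 12 := by decide
  rw [hv, hc] at h
  exact h

/-- **Sextic fourfolds `(4,6)`**: `rank = 19` or `rank ≥ 32` (the `(1,1,1)` and `(1,1,2)` entries of Movasati's table of
complete-intersection codimensions in the sextic Fermat fourfold). [cite: Villaflorloyola2021, Theorem 1.3]
[cite: Movasati2016Periods, §4 table after Thm. 7] -/
theorem rank_periodMatrix_sexticFourfold_eq_or_le (p : (Fin 6 → ℕ) → K)
    (hbox : ∀ i : Fin 6 → ℕ, (∃ e, 5 ≤ i e) → p i = 0) (hne : ∃ i ∈ indexSet 6 6 12, p i ≠ 0) :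
    (periodMatrix 6 6 6 6 p).rank = 19 ∨ 32 ≤ (periodMatrix 6 6 6 6 p).rank := by
  have h := rank_periodMatrix_eq_or_ciLocusCodim_le (n := 4) (d := 6) (by decide) (by norm_num) (by norm_num) p
    hbox hne
  have hv : ciLocusCodim (List.replicate (4 / 2) 1 ++ [2]) 6 = 32 := by decide
  have hc : (4 / 2 + 6).choose 6 - (4 / 2 + 1) ^ 2 = 19 := by decide
  rw [hv, hc] at h
  exact h

/-- **Quartic sixfolds `(6,4)`**: `rank = 19` or `rank ≥ 26`. [cite: Villaflorloyola2021, Theorem 1.3] -/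
theorem rank_periodMatrix_quarticSixfold_eq_or_le (p : (Fin 8 → ℕ) → K)
    (hbox : ∀ i : Fin 8 → ℕ, (∃ e, 3 ≤ i e) → p i = 0) (hne : ∃ i ∈ indexSet 8 4 8, p i ≠ 0) :
    (periodMatrix 8 4 4 4 p).rank = 19 ∨ 26 ≤ (periodMatrix 8 4 4 4 p).rank := by
  have h := rank_periodMatrix_eq_or_ciLocusCodim_le (n := 6) (d := 4) (by decide) (by norm_num) (by norm_num) p
    hbox hne
  have hv : ciLocusCodim (List.replicate (6 / 2) 1 ++ [2]) 4 = 26 := by decide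
  have hc : (6 / 2 + 4).choose 4 - (6 / 2 + 1) ^ 2 = 19 := by decide
  rw [hv, hc] at h
  exact h

/-- **Quartic eightfolds `(8,4)`**: `rank = 45` or `rank ≥ 61`. [cite: Villaflorloyola2021, Theorem 1.3] -/
theorem rank_periodMatrix_quarticEightfold_eq_or_le (p : (Fin 10 → ℕ) → K)
    (hbox : ∀ i : Fin 10 → ℕ, (∃ e, 3 ≤ i e) → p i = 0) (hne : ∃ i ∈ indexSet 10 4 10, p i ≠ 0) :
    (periodMatrix 10 4 6 4 p).rank = 45 ∨ 61 ≤ (periodMatrix 10 4 6 4 p).rank := by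
  have h := rank_periodMatrix_eq_or_ciLocusCodim_le (n := 8) (d := 4) (by decide) (by norm_num) (by norm_num) p
    hbox hne
  have hv : ciLocusCodim (List.replicate (8 / 2) 1 ++ [2]) 4 = 61 := by decide
  have hc : (8 / 2 + 4).choose 4 - (8 / 2 + 1) ^ 2 = 45 := by decide
  rw [hv, hc] at h
  exact h

/-- **Every combination of linear cycles** (the census objects; companion of the tree's
`Movasati2017.movasati_rank_periodMatrix_comb_ge`): for `δ = Σ_k c_k [ℙ^{n/2}_{a_k,b_k}]` on the Fermat `n`-fold
(`n = 2k ≥ 2`, `d ≥ 4`, coefficients in `K`, any `ζ`) whose period vector `p(δ) = Σ c_k p(ℙ_k)` (tree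
`MovasatiVillaflor2018.combPeriod`, MV18 §5) does not vanish on `I_σ`: `rank [p_{i+j}(δ)]` is `C(n/2+d,d) − (n/2+1)²` or
`≥ ciLocusCodim (1^{n/2}, 2) d`. [cite: Villaflorloyola2021, Theorem 1.3] [cite: MovasatiVillaflor2018, §5, Proposition 1] -/
theorem rank_periodMatrix_comb_eq_or_ciLocusCodim_le {n d : ℕ} (hn : Even n) (hn2 : 2 ≤ n) (hd : 4 ≤ d) (ζ : K)
    (δ : List (K × (Fin (n + 2) → ℕ) × Equiv.Perm (Fin (n + 2))))
    (hne : ∃ i ∈ indexSet (n + 2) d ((n / 2 + 1) * (d - 2)), MovasatiVillaflor2018.combPeriod n d ζ δ i ≠ 0) :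
    (periodMatrix (n + 2) d (n / 2 * d - n - 2) d (MovasatiVillaflor2018.combPeriod n d ζ δ)).rank =
        (n / 2 + d).choose d - (n / 2 + 1) ^ 2 ∨
      ciLocusCodim (List.replicate (n / 2) 1 ++ [2]) d ≤
        (periodMatrix (n + 2) d (n / 2 * d - n - 2) d (MovasatiVillaflor2018.combPeriod n d ζ δ)).rank :=
  rank_periodMatrix_eq_or_ciLocusCodim_le hn hn2 hd _
    (fun _ hi => MovasatiVillaflor2018.combPeriod_eq_zero_of_le ζ hn (by omega) δ hi) hne

end CensusRows

end Literature.AlgebraicGeometry.Villaflor2022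

end
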